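import Summits.HodgeConjecture.HodgeConjecture.Theses.GenericDivisibility
import Summits.HodgeConjecture.HodgeConjecture.Theorems.GenericDivisibilityHodgeClassesGenericallyDivisible
import Literature.AlgebraicGeometry.Motives.BettiCycleClassFiniteProofs
import Literature.AlgebraicGeometry.Motives.VarietiesGeometricallyIntegralProofs
import Literature.AlgebraicTopology.SingularHomology.RelativeCochains
import Summits.HodgeConjecture.HodgeConjecture.Theorems.GenericDivisibilityGenericDivisibilityBoundedThomH3TorsionFree
import Summits.HodgeConjecture.HodgeConjecture.Theorems.GenericDivisibilityGenericDivisibilityBoundedSurfaceSaturation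
import Summits.HodgeConjecture.HodgeConjecture.Theorems.GenericDivisibilityGenericDivisibilityBoundedInfinitePrimes
import Summits.HodgeConjecture.HodgeConjecture.Theorems.GenericDivisibilityGenericDivisibilityBoundedSmallChowZero
import Literature.AlgebraicGeometry.Motives.FunctionFieldCohomology
import Literature.Barriers.HodgeConjecture.DecompositionOfTheDiagonal
import Literature.AlgebraicGeometry.Resolution.MarkedIdeals
import Summits.HodgeConjecture.HodgeConjecture.Theorems.GenericDivisibilityGenericDivisibilityBoundedSupportedTop
import Summits.HodgeConjecture.HodgeConjecture.Theorems.GenericDivisibilityGenericDivisibilityBoundedChowZeroBelowTop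
import Summits.HodgeConjecture.HodgeConjecture.Theorems.GenericDivisibilityGenericDivisibilityBoundedSupportedTopOfProduct
import Summits.HodgeConjecture.HodgeConjecture.Theorems.GenericDivisibilityGenericDivisibilityBoundedCruxAtOfSurjective
import Summits.HodgeConjecture.HodgeConjecture.Theorems.GenericDivisibilityGenericDivisibilityBoundedFunctionField
import Summits.HodgeConjecture.HodgeConjecture.Theorems.GenericDivisibilityGenericDivisibilityBoundedHeartStructure
import Summits.HodgeConjecture.HodgeConjecture.Theorems.GenericDivisibilityGenericDivisibilityBoundedRationalCurves
import Summits.HodgeConjecture.HodgeConjecture.Theorems.GenericDivisibilityGenericDivisibilityBoundedOffSupportedTop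
import Summits.HodgeConjecture.HodgeConjecture.Theorems.GenericDivisibilityGenericDivisibilityBoundedFunctionFieldForms
import Summits.HodgeConjecture.HodgeConjecture.Theorems.GenericDivisibilityGenericDivisibilityBoundedBirationalUp
import Summits.HodgeConjecture.HodgeConjecture.Theorems.GenericDivisibilityGenericDivisibilityBoundedHeartDescent
import Summits.HodgeConjecture.HodgeConjecture.Theorems.GenericDivisibilityGenericDivisibilityBoundedHeartFunctionField
import Summits.HodgeConjecture.HodgeConjecture.Theorems.GenericDivisibilityGenericDivisibilityBoundedHeartBirationalUp
import Summits.HodgeConjecture.HodgeConjecture.Theorems.GenericDivisibilityGenericDivisibilityBoundedSupportedTopBirationalUp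
import Summits.HodgeConjecture.HodgeConjecture.Theorems.GenericDivisibilityGenericDivisibilityBoundedBoundedGenericTorsion
import Summits.HodgeConjecture.HodgeConjecture.Theorems.GenericDivisibilityGenericDivisibilityBoundedHeartHodgeOfHC
import Summits.HodgeConjecture.HodgeConjecture.Theorems.GenericDivisibilityGenericDivisibilityBoundedHodgeModConiveauStable
import Summits.HodgeConjecture.HodgeConjecture.Theorems.GenericDivisibilityGenericDivisibilityBoundedFunnelOn
import Summits.HodgeConjecture.HodgeConjecture.Theorems.GenericDivisibilityHodgeBoundedSuffices
import Summits.HodgeConjecture.HodgeConjecture.Theorems.GenericDivisibilityGenericDivisibilityBoundedHeartHodgeIffHC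
import Summits.HodgeConjecture.HodgeConjecture.Theorems.GenericDivisibilityGenericDivisibilityBoundedSNCWitnesses
import Summits.HodgeConjecture.HodgeConjecture.Theorems.GenericDivisibilityGenericDivisibilityBoundedHeartOfHasDegree
import Summits.HodgeConjecture.HodgeConjecture.Theorems.GenericDivisibilityGenericDivisibilityBoundedSNCWitnessesUnconditional
import Literature.AlgebraicGeometry.Resolution.ProjectiveModelsDomination
import Literature.AlgebraicGeometry.HodgeTheory.ComplexOrientationDegreeOne
import Summits.HodgeConjecture.HodgeConjecture.Theorems.GenericDivisibilityGenericDivisibilityBoundedHasDegreeOfSurjective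
import Summits.HodgeConjecture.HodgeConjecture.Theorems.GenericDivisibilityGenericDivisibilityBoundedSmoothRoof

/-!
# Line `finite-level-bootstrap` for the crux `GenericDivisibilityBounded` (stmt-HodgeConjecture-18467)

**Lead reshape (cycle 1, 2026-08-17).** The surface stub `stub_surfaceLevelOne` (p = 1) is cut at
the skeleton level into two registered stubs whose composition is PROVED here
(`surfaceLevelOne_of_saturation`):
* `stub_thomH3TorsionFreeNC` — pure topology: for a closed subset `S = S₀ ⊔ … ⊔ S_{m-1}` of a second
  countable Hausdorff space `W`, finite disjoint union of closed preconnected pieces, straightened by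
  charts `W ⇀ F × K` with `S ↔ {first coordinate = 0}` and `dim_ℝ F ≥ 2`, AND each piece carrying a
  NORMAL COORDINATE (an open `N ⊇ Sᵢ`, `Φ : W → ℂ` continuous on `N`, non-zero on `N ∖ Sᵢ`, reading
  `Φ = c · (e₀ ·).1`, `c` continuous nowhere zero, in ONE straightening chart `e₀ : W ⇀ ℂ × K₀` at a
  point of `Sᵢ` — in the application a local equation of the curve), the relative cohomology
  `H³(W, W ∖ S; ℤ)` is torsion-free (Thom degree `2`: `H₂(W | S; ℤ) ↪ Πᵢ H₂(W | Sᵢ; ℤ)`, each factor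
  cyclic with a generator of infinite order detected by `Φ_*` in `H₂(ℂ | 0; ℤ) ≅ ℤ`, so `H₂` is free
  and the relative Kronecker map `H³ → Hom(H₃, ℤ)` is one-to-one). The normal coordinate is the
  ORIENTATION datum: without it the statement is FALSE (wave-1 worker: core circle of
  `Möbius × ℝ`, `H³(W, W∖S; ℤ) ≅ H²(Klein bottle; ℤ) = ℤ/2`) — the first registered form
  `stub_thomH3TorsionFree` (no orientation) was retired for that reason;
* `stub_surfaceSaturation_of_thomNC` — geometry-to-topology glue: that statement implies SATURATION
  of the image of `H²(X(ℂ);ℤ) → H²((X∖Z)(ℂ);ℤ)` for a smooth projective surface `X` and a proper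
  Zariski-closed `Z` (straighten the curve part of `Z` off a finite set `Z₁` of closed points,
  `H²(X(ℂ)) ≅ H²((X∖Z₁)(ℂ))` across finitely many punctures, long exact sequence of the pair
  `((X∖Z₁)(ℂ), (X∖Z)(ℂ))`, whose `δ` lands in the torsion-free `H³`).
Saturation gives `stub_surfaceLevelOne` in three lines (`M • (z| - ℓ y) = 0 ⇒ (ℓM) • y = (M•z)| ⇒
y = w| ⇒ M • (z - ℓ w)| = 0`). The heart `stub_finiteLevel` is unchanged.
**Status after wave 2 (2026-08-17T07:40Z): BOTH surface stubs LANDED** (p145990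
`Theorems/GenericDivisibilityGenericDivisibilityBoundedThomH3TorsionFree`, p146835
`Theorems/GenericDivisibilityGenericDivisibilityBoundedSurfaceSaturation`) and are imported here;
`surfaceLevelOne_holds` is a theorem; the composition `GenericDivisibilityBounded_of` now has ONE
hypothesis, the heart `stub_finiteLevel` (p ≥ 2, open problem) — the only `sorry` of this file.
**Lead c1, cycle 2 (2026-08-17T09:30Z).** Skeleton unchanged (one open stub, the heart; wave:
none). The proved part of this file LANDED def-free as
`Theorems/GenericDivisibilityGenericDivisibilityBoundedLevelCleanFunnel` (p150537: bootstrap, Krull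
closure of `GT`, bridge, `genericDivisibilityBounded_at_of_levelClean` = C2 at `X` from one clean
level, and the p = 1 crux `genericDivisibilityBounded_one` = registered sub-goal `stub_cruxAtOne`) and
`Theorems/GenericDivisibilityGenericDivisibilityBoundedExtensionDefect` (p151175: bounded torsion of
`H^{k+1}(X(ℂ),(X∖Z)(ℂ);ℤ)` over all proper closed `Z` ⇒ bounded extension defect ⇒ a clean level at
every prime ⇒ C2 at `X` = registered sub-goal `stub_cruxAtOfRelTorsionBound`: the typed plug-in
point for the crux ideas). Heart analysis: crux workfile `HEART-c1.md` (p = 2 localises at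
codimension 2: `Q ≅ ∂₂(H⁴(F₁X)) / ∂₂(Gysin ⊕_D H²(ℂ(D);ℤ))` inside `⊕_{surfaces S} H¹(ℂ(S);ℤ)`;
the heart is crux-sized — recommended for promotion to an item).

**Lead c2, cycle 3 (2026-08-17T10:30Z).** Skeleton unchanged in its composition (one open stub, the
heart; wave: none — 1 stub left). LANDED p154253
`Theorems/GenericDivisibilityGenericDivisibilityBoundedInfinitePrimes` = registered sub-goal
`stub_cruxAtOfInfiniteCleanPrimes`: **C2 at `X` from INFINITELY MANY level-one-clean primes,
Bloch–Kato-free** (lattice algebra on the finitely generated free `H/GT`; the socket for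
`FirstLemmaB'` of idea `galois-rigidity-dichotomy` and the many-ordinary-primes form of idea
`ordinary-prime-periods`), re-exported below as `cruxAtOfInfiniteCleanPrimes_holds` /
`cruxAt_of_infinite_modEllLift`. Heart analysis: crux workfile `HEART-c2.md` (the heart at `ℓ` ⟺
`V_ℓ := (Ñ¹_ℓ ⊗ ℚ)/N¹ = 0`; `V_ℓ` is Galois-stable for every field of definition; at an ordinary
prime `V_p` lies in the kernel of the Bloch–Kato unit-root symbol, which proves the heart for `E⁴`
(all `E`) and the CRUX for every `X` with Mumford–Tate + de Rham projectors + GHC in coniveau 1 +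
one ordinary prime; the residual question is the generic divisibility of Hodge–Tate-invisible
Galois constituents).

**Lead c3, cycle 5 (2026-08-17T11:50Z).** Skeleton unchanged in its composition (one open stub, the
heart; wave: none — 1 stub left). LANDED p157362
`Theorems/GenericDivisibilityGenericDivisibilityBoundedSmallChowZero` = registered sub-goal
`stub_cruxAtOfChowRankLEOneUpToZero`: **the Bloch–Srinivas sector — C2 at `X` AND the heart at `X`
at every prime and every level, for every smooth projective `2p`-fold (`p ≥ 1`) with `CH₀ ⊗ ℚ` of rank
`≤ 1`**, Hodge-free and unconditional (generalised decomposition of the diagonal with `k₀ = 0`, PROVED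
in the tree, through the unconditional complex-orientation Gysin formalism: ONE divisor complement kills
every positive-degree class over `ℂ`; Dimca finiteness + universal coefficients make every integral
class generically torsion there, `E = 0`), re-exported below as `levelClean_of_chowRankLEOneUpTo_zero` /
`cruxAt_of_chowRankLEOneUpTo_zero`; and the line's composition `heart ⇒ crux` as the durable Theorems
record `genericDivisibilityBounded_of_oneCleanPrime` (registered sub-goal `stub_cruxOfOneCleanPrime`),
with the sharpening `…_off_chowRankLEOneUpTo_zero`: **the heart is only needed on `2p`-folds whose
`0`-cycles have `ℚ`-rank `≥ 2`** (the `H^{2p,0} ≠ 0` arena of HEART-c2 §F). Heart analysis: crux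
workfile `HEART-c3.md`.

**Lead c4, cycle 6 (2026-08-17).** Composition unchanged (ONE open stub of the composition, the heart,
held by the lead; `wave: none` possible only after this cycle). THIRTEEN new registered sub-goals, all LANDED
(three waves of in-session workers + lead files; crux workfile `HEART-c4.md`):
* `stub_heartOfSupportedTop` (p160596) — `GT = N¹ ∩ H_ℤ`; **the heart at every `(ℓ, s)` and C2 on every `X`
  with `N¹H^{2p}(X(ℂ);ℂ) = H^{2p}(X(ℂ);ℂ)`**: the exact open locus of the heart is `{X : N¹H^{2p} ≠ H^{2p}}`
  (GHC-shape `h^{2p,0} ≠ 0`); `stub_cruxOfOneCleanPrimeOffSupportedTop` (p162249) — the sharpest consumer;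
* sectors inside it: `stub_heartOfChowZeroSupportedBelowTop` (p160943: `CH₀` supported in dimension `< 2p`,
  i.e. on a divisor), `stub_heartOfCoveredByRationalCurves` (p161921: uniruled `2p`-folds, hypersurfaces of
  degree `≤ 2p`), `stub_supportedTopOfProduct` (p160876: Künneth — `S ⊗ Y` with `p_g(S) = 0`, `Y` arbitrary,
  e.g. `Enriques ⊗ K3` with `CH₀` large), domination (p161788);
* structure: `stub_heartIffBoundedLoss` + level monotonicity (p161788); `stub_cruxAtOfSurjective` (p160936)
  and `stub_cruxAtOfBirationalUp` (p162489) — **C2 descends along surjections and is a BIRATIONAL INVARIANT**;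
  `stub_heartOfHasDegreeCoprime` (p162684) — **the heart descends along surjective maps of degree prime to `ℓ`
  and from any smooth birational model**;
* vocabulary: `stub_genericallyDivisibleIffFunctionField` (p160865), `stub_cruxAtIffFunctionField` (p162355),
  `stub_levelDivisibleIffFunctionField` / `stub_levelCleanIffFunctionField` (p163474) — the crux, `GT` and the
  heart entirely at the generic point `H^{2p}(ℂ(X);ℤ) = functionFieldCohomology ℤ X (2p)`.

**Idea.** C2 is an intersection over ALL `m ≥ 1` of divisibility conditions at the generic point.
This line cuts it to ONE prime `ℓ` and ONE finite level `ℓ^s`: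

* `GenericallyTorsion x` ("`x ∈ GT`"): `x` is killed by some `N ≥ 1` on the complex points of some
  non-empty Zariski open (⟺ `x ⊗ ℚ` has coniveau `≥ 1`; `GT = (N¹H²ᵖ(X;ℤ))^{sat}`).
* `DivisibleUpToTorsionOnOpen m z` ("`D'(m,z)`"): on some non-empty Zariski open, `z| - m • y` is
  killed by some `M ≥ 1` (for `M = 1` this is the hypothesis of the crux; granted Colliot-Thélène–
  Voisin Thm 3.1 the two are equivalent, but the line never needs that).
* `LevelClean ℓ s p X` ("`P(ℓ,s)`"): every `z` with `D'(ℓ^s, z)` lies in `ℓ • H + GT`.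

Stubs (the heart + the known surface case; the bootstrap and all glue are PROVED):
* `stub_finiteLevel` (HEART, open for `p ≥ 2`): some prime `ℓ` and some level `s ≥ 1` are clean.
  Equivalently: the `ℓ`-primary defect `(N¹H²ᵖ(X;ℤ/ℓ^r) ∩ H²ᵖ(X;ℤ)/ℓ^r) / N¹H²ᵖ(X;ℤ)` has exponent
  `< ℓ^r` at SOME level `r` — i.e. `T_ℓ(H²ᵖ_nr(X;ℤ)/H²ᵖ(X;ℤ)) = 0` with small finite part, at one
  prime of our choosing.
* `stub_surfaceLevelOne` (`p = 1`, every prime, level 1; classical: `H³_D(S;ℤ) ≅ H₁(D;ℤ)` is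
  torsion-free for a curve configuration `D`, so `H²(S;ℤ)/⟨Dᵢ⟩` is saturated in `H²((S∖D)(ℂ);ℤ)`).
* (proved, `bootstrap`; pure algebra + directedness of opens, NO Bloch–Kato): a clean level `s`
  propagates up the `ℓ`-adic tower with constant loss `s - 1`:
  `D'(ℓ^{n+s}, z) ⇒ z ∈ ℓ^{n+1} • H + GT` for all `n`.

Composition `GenericDivisibilityBounded_of` (PROVED here, no sorry): the crux hypothesis gives
`D'(ℓ^{n+s}, z)` for all `n`; the stubs give `z ∈ ⋂ₙ (ℓ^{n+1} • H + GT)`; `GT` is a SATURATED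
subgroup (proved here: irreducibility of `X` makes the non-empty opens directed), `H = H²ᵖ(X(ℂ);ℤ)`
is finitely generated (tree: `bettiCohomologyInt_finite_holds`), so `H/GT` is finitely generated and
torsion-free and Krull's intersection theorem (`Ideal.iInf_pow_smul_eq_bot_of_isTorsionFree`) forces
`z ∈ GT`; finally `GT ⊗ ℂ ⊆ N¹ H²ᵖ(X(ℂ);ℂ) = supportedClasses X (2p) 1` (proved here: change of
coefficients commutes with restriction, and a proper closed subset of the integral `X` has
codimension `≥ 1`).
-/

set_option linter.dupNamespace false

noncomputable section

namespace Summit.HodgeConjecture.HodgeConjecture.Cruxes.GenericDivisibilityBounded.FiniteLevelBootstrap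

open CategoryTheory AlgebraicGeometry MonoidalCategory
open Literature.AlgebraicGeometry.Motives Literature.AlgebraicGeometry.HodgeTheory
  Literature.AlgebraicTopology.SingularHomology
open Literature.Barriers.HodgeConjecture (HasChowZeroSupportedInDimLE)
open Summit.HodgeConjecture.HodgeConjecture.Theses.GenericDivisibility
open Summit.HodgeConjecture.HodgeConjecture.Theorems

/-! ### Vocabulary (abbreviations over existing declarations only) -/

/-- `H^k(X(ℂ); ℤ)`. -/
abbrev Hint (X : SchemeOver ℂ) (k : ℕ) : ModuleCat.{0} ℤ :=
  singularCohomology ℤ ℤ (ComplexPoints X) k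

/-- Restriction `H^k(X(ℂ);ℤ) ⟶ H^k((X∖Z)(ℂ);ℤ)` — the very term used in the crux. -/
abbrev res (X : SchemeOver ℂ) (Z : Set X.left) (k : ℕ) :
    Hint X k ⟶ singularCohomology ℤ ℤ (complexPointsCompl X Z) k :=
  singularCohomology.map ℤ ℤ
    (⟨Subtype.val, continuous_subtype_val⟩ : C(complexPointsCompl X Z, ComplexPoints X)) k

/-- `x ∈ GT`: `x` is torsion on the complex points of some non-empty Zariski open
(⟺ `x ⊗ ℚ ∈ N¹`, the rational shadow of coniveau `≥ 1`). -/
def GenericallyTorsion (X : SchemeOver ℂ) (k : ℕ) (x : Hint X k) : Prop :=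
  ∃ Z : Set X.left, IsClosed Z ∧ Z ≠ Set.univ ∧ ∃ N : ℕ, 1 ≤ N ∧ N • res X Z k x = 0

/-- `D'(m, z)`: on some non-empty Zariski open, `z` is congruent to an `m`-multiple modulo a class
killed by some `M ≥ 1`. -/
def DivisibleUpToTorsionOnOpen (X : SchemeOver ℂ) (k : ℕ) (m : ℕ) (z : Hint X k) : Prop :=
  ∃ Z : Set X.left, IsClosed Z ∧ Z ≠ Set.univ ∧
    ∃ (y : singularCohomology ℤ ℤ (complexPointsCompl X Z) k) (M : ℕ), 1 ≤ M ∧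
      M • (res X Z k z - m • y) = 0

/-- `P(ℓ, s)` at `(p, X)`: level `ℓ^s` is CLEAN — divisibility by `ℓ^s` up to torsion on an open
forces divisibility by `ℓ` modulo generically-torsion classes. -/
def LevelClean (ℓ s p : ℕ) (X : SchemeOver ℂ) : Prop :=
  ∀ z : Hint X (2 * p), DivisibleUpToTorsionOnOpen X (2 * p) (ℓ ^ s) z →
    ∃ w : Hint X (2 * p), GenericallyTorsion X (2 * p) (z - ℓ • w)

/-! ### Registered stubs (`sorry` only here; signatures def-free and self-contained — the
`Sig.*` legends below are the same texts, and `sig_*_iff` check they are the `LevelClean` forms) -/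

/-- Statement of `stub_finiteLevel` (the HEART), def-free. -/
def Sig.stub_finiteLevel : Prop :=
  ∀ ⦃p : ℕ⦄ ⦃X : SchemeOver ℂ⦄, 2 ≤ p → IsSmoothProjective (2 * p) X →
    ∃ ℓ s : ℕ, ℓ.Prime ∧ 1 ≤ s ∧
      ∀ z : singularCohomology ℤ ℤ (ComplexPoints X) (2 * p),
        (∃ Z : Set X.left, IsClosed Z ∧ Z ≠ Set.univ ∧
          ∃ (y : singularCohomology ℤ ℤ (complexPointsCompl X Z) (2 * p)) (M : ℕ), 1 ≤ M ∧
            M • (singularCohomology.map ℤ ℤ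
              (⟨Subtype.val, continuous_subtype_val⟩ : C(complexPointsCompl X Z, ComplexPoints X))
              (2 * p) z - ℓ ^ s • y) = 0) →
        ∃ w : singularCohomology ℤ ℤ (ComplexPoints X) (2 * p),
          ∃ Z : Set X.left, IsClosed Z ∧ Z ≠ Set.univ ∧ ∃ N : ℕ, 1 ≤ N ∧
            N • singularCohomology.map ℤ ℤ
              (⟨Subtype.val, continuous_subtype_val⟩ : C(complexPointsCompl X Z, ComplexPoints X))
              (2 * p) (z - ℓ • w) = 0

/-- Statement of `stub_surfaceLevelOne` (the known surface case), def-free. -/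
def Sig.stub_surfaceLevelOne : Prop :=
  ∀ ⦃X : SchemeOver ℂ⦄, IsSmoothProjective (2 * 1) X → ∀ ℓ : ℕ, ℓ.Prime →
    ∀ z : singularCohomology ℤ ℤ (ComplexPoints X) (2 * 1),
      (∃ Z : Set X.left, IsClosed Z ∧ Z ≠ Set.univ ∧
        ∃ (y : singularCohomology ℤ ℤ (complexPointsCompl X Z) (2 * 1)) (M : ℕ), 1 ≤ M ∧
          M • (singularCohomology.map ℤ ℤ
            (⟨Subtype.val, continuous_subtype_val⟩ : C(complexPointsCompl X Z, ComplexPoints X))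
            (2 * 1) z - ℓ ^ 1 • y) = 0) →
      ∃ w : singularCohomology ℤ ℤ (ComplexPoints X) (2 * 1),
        ∃ Z : Set X.left, IsClosed Z ∧ Z ≠ Set.univ ∧ ∃ N : ℕ, 1 ≤ N ∧
          N • singularCohomology.map ℤ ℤ
            (⟨Subtype.val, continuous_subtype_val⟩ : C(complexPointsCompl X Z, ComplexPoints X))
            (2 * 1) (z - ℓ • w) = 0

/-- Statement of `stub_thomH3TorsionFreeNC` (pure topology, the Thom degree `2`), def-free:
for a closed subset `S = ⋃ᵢ Sᵢ` of a second countable Hausdorff space `W`, finite disjoint union of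
closed preconnected pieces, straightened by charts `W ⇀ F × K` (`S ↔ (·).1 = 0`, `dim_ℝ F ≥ 2`),
each piece carrying a normal coordinate (orientation datum), the relative cohomology
`H³(W, W ∖ S; ℤ)` is torsion-free. -/
def Sig.stub_thomH3TorsionFreeNC : Prop :=
  ∀ {W : Type} [TopologicalSpace W] [SecondCountableTopology W] [T2Space W]
    {m : ℕ} (S : Fin m → Set W),
    (∀ i, IsClosed (S i)) → (∀ i, IsPreconnected (S i)) →
    (∀ i j, i ≠ j → Disjoint (S i) (S j)) →
    (∀ x ∈ ⋃ i, S i, ∃ (F : Type) (_ : NormedAddCommGroup F) (_ : NormedSpace ℝ F)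
        (_ : FiniteDimensional ℝ F) (K : Type) (_ : NormedAddCommGroup K) (_ : NormedSpace ℝ K)
        (e : OpenPartialHomeomorph W (F × K)),
        2 ≤ Module.finrank ℝ F ∧ x ∈ e.source ∧ ∀ z ∈ e.source, z ∈ (⋃ i, S i) ↔ (e z).1 = 0) →
    (∀ i, ∃ (N : Set W) (Φ c : W → ℂ) (K₀ : Type) (_ : NormedAddCommGroup K₀) (_ : NormedSpace ℝ K₀)
        (e₀ : OpenPartialHomeomorph W (ℂ × K₀)) (s₀ : W),
        IsOpen N ∧ S i ⊆ N ∧ ContinuousOn Φ N ∧ (∀ z ∈ N, Φ z = 0 → z ∈ S i) ∧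
        (∀ z ∈ e₀.source, z ∈ S i ↔ (e₀ z).1 = 0) ∧ s₀ ∈ e₀.source ∧ s₀ ∈ S i ∧
        ContinuousOn c e₀.source ∧ (∀ z ∈ e₀.source, c z ≠ 0) ∧
        ∀ z ∈ e₀.source, Φ z = c z * (e₀ z).1) →
    ∀ (c : relSingularCohomology ℤ ℤ W (⋃ i, S i)ᶜ 3) (k : ℕ), 1 ≤ k → k • c = 0 → c = 0

/-- Statement of the SATURATION of `H²(X(ℂ);ℤ)` inside `H²((X∖Z)(ℂ);ℤ)` for a smooth projective
surface `X` and a proper Zariski-closed `Z`, def-free: if `k • y` (`k ≥ 1`) is the restriction of a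
global class, so is `y`. -/
def Sig.surfaceSaturation : Prop :=
  ∀ ⦃X : SchemeOver ℂ⦄, IsSmoothProjective (2 * 1) X → ∀ (Z : Set X.left), IsClosed Z →
    Z ≠ Set.univ → ∀ (y : singularCohomology ℤ ℤ (complexPointsCompl X Z) (2 * 1)) (k : ℕ), 1 ≤ k →
      (∃ w : singularCohomology ℤ ℤ (ComplexPoints X) (2 * 1),
        singularCohomology.map ℤ ℤ
          (⟨Subtype.val, continuous_subtype_val⟩ : C(complexPointsCompl X Z, ComplexPoints X))
          (2 * 1) w = k • y) →
      ∃ w : singularCohomology ℤ ℤ (ComplexPoints X) (2 * 1),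
        singularCohomology.map ℤ ℤ
          (⟨Subtype.val, continuous_subtype_val⟩ : C(complexPointsCompl X Z, ComplexPoints X))
          (2 * 1) w = y

/-- Statement of `stub_surfaceSaturation_of_thomNC` (geometry-to-topology glue), def-free: the
topological torsion-freeness `Sig.stub_thomH3TorsionFreeNC` implies `Sig.surfaceSaturation`
(both texts inlined verbatim). -/
def Sig.stub_surfaceSaturation_of_thomNC : Prop :=
  (∀ {W : Type} [TopologicalSpace W] [SecondCountableTopology W] [T2Space W]
    {m : ℕ} (S : Fin m → Set W),
    (∀ i, IsClosed (S i)) → (∀ i, IsPreconnected (S i)) →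
    (∀ i j, i ≠ j → Disjoint (S i) (S j)) →
    (∀ x ∈ ⋃ i, S i, ∃ (F : Type) (_ : NormedAddCommGroup F) (_ : NormedSpace ℝ F)
        (_ : FiniteDimensional ℝ F) (K : Type) (_ : NormedAddCommGroup K) (_ : NormedSpace ℝ K)
        (e : OpenPartialHomeomorph W (F × K)),
        2 ≤ Module.finrank ℝ F ∧ x ∈ e.source ∧ ∀ z ∈ e.source, z ∈ (⋃ i, S i) ↔ (e z).1 = 0) →
    (∀ i, ∃ (N : Set W) (Φ c : W → ℂ) (K₀ : Type) (_ : NormedAddCommGroup K₀) (_ : NormedSpace ℝ K₀)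
        (e₀ : OpenPartialHomeomorph W (ℂ × K₀)) (s₀ : W),
        IsOpen N ∧ S i ⊆ N ∧ ContinuousOn Φ N ∧ (∀ z ∈ N, Φ z = 0 → z ∈ S i) ∧
        (∀ z ∈ e₀.source, z ∈ S i ↔ (e₀ z).1 = 0) ∧ s₀ ∈ e₀.source ∧ s₀ ∈ S i ∧
        ContinuousOn c e₀.source ∧ (∀ z ∈ e₀.source, c z ≠ 0) ∧
        ∀ z ∈ e₀.source, Φ z = c z * (e₀ z).1) →
    ∀ (c : relSingularCohomology ℤ ℤ W (⋃ i, S i)ᶜ 3) (k : ℕ), 1 ≤ k → k • c = 0 → c = 0) →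
  ∀ ⦃X : SchemeOver ℂ⦄, IsSmoothProjective (2 * 1) X → ∀ (Z : Set X.left), IsClosed Z →
    Z ≠ Set.univ → ∀ (y : singularCohomology ℤ ℤ (complexPointsCompl X Z) (2 * 1)) (k : ℕ), 1 ≤ k →
      (∃ w : singularCohomology ℤ ℤ (ComplexPoints X) (2 * 1),
        singularCohomology.map ℤ ℤ
          (⟨Subtype.val, continuous_subtype_val⟩ : C(complexPointsCompl X Z, ComplexPoints X))
          (2 * 1) w = k • y) →
      ∃ w : singularCohomology ℤ ℤ (ComplexPoints X) (2 * 1),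
        singularCohomology.map ℤ ℤ
          (⟨Subtype.val, continuous_subtype_val⟩ : C(complexPointsCompl X Z, ComplexPoints X))
          (2 * 1) w = y

/-- The glue legend is `thom → saturation`, on the nose. -/
theorem sig_stub_surfaceSaturation_of_thomNC_iff :
    Sig.stub_surfaceSaturation_of_thomNC ↔ (Sig.stub_thomH3TorsionFreeNC → Sig.surfaceSaturation) :=
  Iff.rfl

/-- The legend of the heart is the `LevelClean` form, on the nose. -/
theorem sig_stub_finiteLevel_iff :
    Sig.stub_finiteLevel ↔
      ∀ ⦃p : ℕ⦄ ⦃X : SchemeOver ℂ⦄, 2 ≤ p → IsSmoothProjective (2 * p) X →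
        ∃ ℓ s : ℕ, ℓ.Prime ∧ 1 ≤ s ∧ LevelClean ℓ s p X :=
  Iff.rfl

/-- The legend of the surface case is the `LevelClean ℓ 1 1` form, on the nose. -/
theorem sig_stub_surfaceLevelOne_iff :
    Sig.stub_surfaceLevelOne ↔
      ∀ ⦃X : SchemeOver ℂ⦄, IsSmoothProjective (2 * 1) X → ∀ ℓ : ℕ, ℓ.Prime → LevelClean ℓ 1 1 X :=
  Iff.rfl

/-- **HEART (open for `p ≥ 2`).** On a smooth projective complex `2p`-fold, SOME prime `ℓ` has SOME
clean finite level `ℓ^s`: `D'(ℓ^s, z) ⇒ z ∈ ℓ • H²ᵖ(X;ℤ) + GT`.  Equivalent (granted CT–V 3.1) to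
bounded `ℓ`-adic loss along the whole tower (the bootstrap below propagates a clean level with
constant loss `s - 1`), i.e. to `T_ℓ(H²ᵖ_nr(X;ℤ)/H²ᵖ(X;ℤ)) = 0` plus a finite part, i.e. to
`lim_r N¹H²ᵖ(X;ℤ/ℓ^r) = N¹H²ᵖ(X;ℤ) ⊗ ℤ_ℓ` up to a finite group — at ONE prime of our choosing.
Fed by both crux ideas: `galois-rigidity-dichotomy` proves it with `s = 1` at every large `ℓ` for
`E⁴`; `formality-denominators` (BRT with bound `e`) gives it at every `ℓ` with `s = v_ℓ(e) + 1`.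
Strictly stronger than the single-prime crux (an irrationally placed phantom module kills it). -/
theorem stub_finiteLevel :
    ∀ ⦃p : ℕ⦄ ⦃X : SchemeOver ℂ⦄, 2 ≤ p → IsSmoothProjective (2 * p) X →
      ∃ ℓ s : ℕ, ℓ.Prime ∧ 1 ≤ s ∧
        ∀ z : singularCohomology ℤ ℤ (ComplexPoints X) (2 * p),
          (∃ Z : Set X.left, IsClosed Z ∧ Z ≠ Set.univ ∧
            ∃ (y : singularCohomology ℤ ℤ (complexPointsCompl X Z) (2 * p)) (M : ℕ), 1 ≤ M ∧
              M • (singularCohomology.map ℤ ℤ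
                (⟨Subtype.val, continuous_subtype_val⟩ : C(complexPointsCompl X Z, ComplexPoints X))
                (2 * p) z - ℓ ^ s • y) = 0) →
          ∃ w : singularCohomology ℤ ℤ (ComplexPoints X) (2 * p),
            ∃ Z : Set X.left, IsClosed Z ∧ Z ≠ Set.univ ∧ ∃ N : ℕ, 1 ≤ N ∧
              N • singularCohomology.map ℤ ℤ
                (⟨Subtype.val, continuous_subtype_val⟩ : C(complexPointsCompl X Z, ComplexPoints X))
                (2 * p) (z - ℓ • w) = 0 := by
  sorry

/-- **Surface case (`p = 1`, known).** On a smooth projective surface every prime is clean at level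
one: for a proper Zariski-closed `D ⊂ S` (curves and points), `H²(S;ℤ) → H²((S∖D)(ℂ);ℤ)` has
kernel `⟨[Dᵢ]⟩ ⊆ NS(S)` and cokernel inside `H³_D(S;ℤ) ≅ H₁(D(ℂ);ℤ)` (Alexander–Lefschetz duality on
the compact 4-manifold `S(ℂ)`), which is torsion-free (the normalisation of a compact complex curve
is a homeomorphism off finitely many points, and identifying finitely many points adds free loops),
so the image of `H²(S;ℤ)` is saturated and contains the torsion of `H²(U;ℤ)`; hence
`z| ≡ ℓ y (mod torsion)` forces `y = w|` and `z - ℓ w ∈ ker(res) + {torsion on U} ⊆ GT`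
(Colliot-Thélène–Voisin 2012 §4.1: `0 → NS → H² → H²_nr → 0`). -/
theorem sig_stub_surfaceLevelOne_text : Sig.stub_surfaceLevelOne ↔
    ∀ ⦃X : SchemeOver ℂ⦄, IsSmoothProjective (2 * 1) X → ∀ ℓ : ℕ, ℓ.Prime →
      ∀ z : singularCohomology ℤ ℤ (ComplexPoints X) (2 * 1),
        (∃ Z : Set X.left, IsClosed Z ∧ Z ≠ Set.univ ∧
          ∃ (y : singularCohomology ℤ ℤ (complexPointsCompl X Z) (2 * 1)) (M : ℕ), 1 ≤ M ∧
            M • (singularCohomology.map ℤ ℤ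
              (⟨Subtype.val, continuous_subtype_val⟩ : C(complexPointsCompl X Z, ComplexPoints X))
              (2 * 1) z - ℓ ^ 1 • y) = 0) →
        ∃ w : singularCohomology ℤ ℤ (ComplexPoints X) (2 * 1),
          ∃ Z : Set X.left, IsClosed Z ∧ Z ≠ Set.univ ∧ ∃ N : ℕ, 1 ≤ N ∧
            N • singularCohomology.map ℤ ℤ
              (⟨Subtype.val, continuous_subtype_val⟩ : C(complexPointsCompl X Z, ComplexPoints X))
              (2 * 1) (z - ℓ • w) = 0 :=
  Iff.rfl

/-- **LANDED (p145990) — pure topology, the Thom degree `2`, with orientation datum.** For a closed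
subset `S = ⋃ᵢ Sᵢ` (`i < m`) of a second countable Hausdorff space `W` — finite disjoint union of
closed preconnected pieces, straightened by charts `e : W ⇀ F × K` with `z ∈ S ↔ (e z).1 = 0` on
`e.source` and `dim_ℝ F ≥ 2`, each piece `Sᵢ` carrying a normal coordinate `Φ` (open `N ⊇ Sᵢ`,
`Φ : W → ℂ` continuous on `N` with zeros inside `Sᵢ`, `Φ = c · (e₀ ·).1` with `c` continuous nowhere
zero on the source of one straightening chart `e₀ : W ⇀ ℂ × K₀` at a point `s₀ ∈ Sᵢ`) — the relative
cohomology `H³(W, W ∖ S; ℤ)` is torsion-free. PROVED by the wave-1 worker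
(`thomH3TorsionFree_of_normalCoordinate`, work/stubs/stub_thomH3TorsionFree.lean).
Proof sketch (all engines in the tree): `H_j(W | S) = 0` for `j < 2`
(`isZero_localHomologyOfSet_of_locallyFlat`); `H₂(W | S; ℤ) ≅ ⊕ᵢ H₂(W | Sᵢ; ℤ)` (relative
Mayer–Vietoris for the disjoint closed pieces, `LocalHomologyMayerVietoris`); each `H₂(W | Sᵢ; ℤ)` is
cyclic (`exists_forall_mem_span_localHomologyOfSet_of_locallyFlat`, `k = 2`) and its generator is `0`
or of infinite order (restrict to a straightened ball, `LocallyFlatThomLocalModel`: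
`H₂(B | L; ℤ) ≅ H₂(F | 0; ℤ) ≅ ℤ` when `dim F = 2`, `= 0` when `dim F ≥ 3`), so `H₂(W | S; ℤ)` is free;
hence the relative Kronecker map `H³(W, W∖S; ℤ) → Hom(H₃(W, W∖S; ℤ), ℤ)` is one-to-one
(`relKronecker_injective_succ`, `m = 2`, projectivity from freeness via
`relativeSingularHomology.concreteIso`), and its target is torsion-free. -/
theorem thomH3TorsionFreeNC_holds : Sig.stub_thomH3TorsionFreeNC :=
  fun S hS hSc hdisj hflat hnc ↦
    Summit.HodgeConjecture.HodgeConjecture.Theorems.stub_thomH3TorsionFreeNC S hS hSc hdisj hflat hnc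

/-- **LANDED (p146835) — geometry-to-topology glue for the surface case.** The topological
torsion-freeness above implies SATURATION of `im (H²(X(ℂ);ℤ) → H²((X∖Z)(ℂ);ℤ))` for `X` a smooth
projective surface and `Z ⊊ X` Zariski-closed.
Proof sketch (pattern: `HodgeTheory.exists_ker_restrictCompl_le_span_of_isIrreducible`,
`Barriers.HodgeConjecture.restrictComplInt_bijective_of_finite`): every point of `Z` has codimension
`≥ 1` (`Motives.forall_one_le_coheight_iff_ne_univ`); straighten `Z(ℂ)` off a closed `Z₁ ⊆ Z` of
codimension `≥ 2` (`GAGADimension.exists_closed_straightening_off`, `c = 1`), enlarge `Z₁` by the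
pairwise intersections of the irreducible components `Cⱼ` of `Z` and by its point components — still a
finite set of closed points; in `W = (X∖Z₁)(ℂ)` (second countable, Hausdorff:
`ComplexPoints.secondCountableTopology_of_compactSpace_holds`, `t2Space_of_isSmoothProjective`) the
pieces `Sⱼ = {Q | Q.pt ∈ Cⱼ}` are closed, pairwise disjoint, preconnected
(`ComplexPoints.isConnected_setOf_pt_mem_inter_of_isIrreducible`) and straightened by the restricted
charts (`OpenPartialHomeomorph.subtypeRestr`), with `⋃ Sⱼ = {Q | Q.pt ∈ Z}` and
`(⋃ Sⱼ)ᶜ ≃ₜ (X∖Z)(ℂ)`; `H²(X(ℂ);ℤ) → H²(W;ℤ)` is bijective (`restrictComplInt_bijective_of_finite`,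
`n = k = 2`); in the long exact sequence `H²(W) → H²(W∖S) —δ→ H³(W, W∖S)`
(`relSingularCohomology.exact_map_δ`) a class `y` with `k • y` global has `k • δ y = 0`, so `δ y = 0`
by the topological stub, so `y` comes from `H²(W) = H²(X(ℂ))`. -/
theorem surfaceSaturation_of_thomNC_holds : Sig.stub_surfaceSaturation_of_thomNC :=
  fun hThom ↦ Summit.HodgeConjecture.HodgeConjecture.Theorems.stub_surfaceSaturation_of_thomNC hThom

/-- **Saturation ⇒ the surface case** (`LevelClean ℓ 1 1 X` for every prime `ℓ`), PROVED:
from `M • (z| - ℓ • y) = 0` the class `(M ℓ) • y = (M • z)|` is global, so `y = w|` by saturation,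
and `M • (z - ℓ • w)| = M • (z| - ℓ • y) = 0` on the same open. -/
theorem surfaceLevelOne_of_saturation : Sig.surfaceSaturation → Sig.stub_surfaceLevelOne := by
  intro hsat X hX ℓ hℓ z hz
  obtain ⟨Z, hZ, hZne, y, M, hM, hMz⟩ := hz
  rw [pow_one, smul_sub, sub_eq_zero, ← mul_smul] at hMz
  -- `(M ℓ) • y` is the restriction of the global class `M • z`
  obtain ⟨w, hw⟩ := hsat hX Z hZ hZne y (M * ℓ)
    (Nat.one_le_iff_ne_zero.2 (Nat.mul_ne_zero (by omega) hℓ.ne_zero)) ⟨M • z, by rw [map_nsmul, hMz]⟩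
  refine ⟨w, Z, hZ, hZne, M, hM, ?_⟩
  rw [map_sub, map_nsmul, hw, smul_sub, ← mul_smul, hMz, sub_self]

/-- The surface case, DERIVED from the two landed theorems (p145990, p146835). -/
theorem surfaceLevelOne_holds : Sig.stub_surfaceLevelOne :=
  surfaceLevelOne_of_saturation (surfaceSaturation_of_thomNC_holds thomH3TorsionFreeNC_holds)


/-! The former third stub, the BOOTSTRAP, is PROVED below (`bootstrap`, after the subgroup lemmas):
a clean level `s` propagates up the whole `ℓ`-adic tower with constant loss `s - 1`, by pure algebra plus
directedness of the non-empty Zariski opens — no Bloch–Kato input. -/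

/-! ### Proved glue 1: `GT` is a saturated subgroup -/

/-- In the irreducible `X`, two proper Zariski-closed subsets have proper union. -/
theorem union_ne_univ {X : SchemeOver ℂ} [IrreducibleSpace X.left] {Z₁ Z₂ : Set X.left}
    (hZ₁ : IsClosed Z₁) (hZ₂ : IsClosed Z₂) (h₁ : Z₁ ≠ Set.univ) (h₂ : Z₂ ≠ Set.univ) :
    Z₁ ∪ Z₂ ≠ Set.univ := by
  intro h
  rcases isPreirreducible_iff_isClosed_union_isClosed.mp
      (PreirreducibleSpace.isPreirreducible_univ (X := X.left)) Z₁ Z₂ hZ₁ hZ₂ h.symm.subset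
      with h' | h'
  · exact h₁ (Set.eq_univ_of_univ_subset h')
  · exact h₂ (Set.eq_univ_of_univ_subset h')

/-- Restriction to `(X ∖ (Z₁ ∪ Z₂))(ℂ)` kills what restriction to `(X ∖ Z₁)(ℂ)` kills after a
multiple, and symmetrically (functoriality of restriction along `Z₁ ⊆ Z₁ ∪ Z₂`). -/
theorem nsmul_res_union_eq_zero_left {X : SchemeOver ℂ} {Z₁ Z₂ : Set X.left} {k N : ℕ}
    {x : Hint X k} (hx : N • res X Z₁ k x = 0) : N • res X (Z₁ ∪ Z₂) k x = 0 := by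
  have h := congrArg (singularCohomology.map ℤ ℤ
    (⟨fun P : complexPointsCompl X (Z₁ ∪ Z₂) =>
        (⟨P.1, fun hP : P.1.pt ∈ Z₁ => P.2 (Set.subset_union_left hP)⟩ : complexPointsCompl X Z₁),
      continuous_subtype_val.subtype_mk fun (P : complexPointsCompl X (Z₁ ∪ Z₂))
        (hP : P.1.pt ∈ Z₁) => P.2 (Set.subset_union_left hP)⟩ :
      C(complexPointsCompl X (Z₁ ∪ Z₂), complexPointsCompl X Z₁)) k) hx
  rw [map_zero, map_nsmul] at h
  change N • singularCohomology.map ℤ ℤ _ k (singularCohomology.map ℤ ℤ _ k x) = 0 at h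
  rwa [genericDivisibility_restrict_restrict ℤ Set.subset_union_left] at h

theorem nsmul_res_union_eq_zero_right {X : SchemeOver ℂ} {Z₁ Z₂ : Set X.left} {k N : ℕ}
    {x : Hint X k} (hx : N • res X Z₂ k x = 0) : N • res X (Z₁ ∪ Z₂) k x = 0 := by
  have h := congrArg (singularCohomology.map ℤ ℤ
    (⟨fun P : complexPointsCompl X (Z₁ ∪ Z₂) =>
        (⟨P.1, fun hP : P.1.pt ∈ Z₂ => P.2 (Set.subset_union_right hP)⟩ : complexPointsCompl X Z₂),
      continuous_subtype_val.subtype_mk fun (P : complexPointsCompl X (Z₁ ∪ Z₂))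
        (hP : P.1.pt ∈ Z₂) => P.2 (Set.subset_union_right hP)⟩ :
      C(complexPointsCompl X (Z₁ ∪ Z₂), complexPointsCompl X Z₂)) k) hx
  rw [map_zero, map_nsmul] at h
  change N • singularCohomology.map ℤ ℤ _ k (singularCohomology.map ℤ ℤ _ k x) = 0 at h
  rwa [genericDivisibility_restrict_restrict ℤ Set.subset_union_right] at h

/-- **`GT` is a subgroup** of `H^k(X(ℂ);ℤ)`: the non-empty Zariski opens of the irreducible `X` are
directed, and restriction is additive. -/
def genericallyTorsionAddSubgroup (X : SchemeOver ℂ) [IrreducibleSpace X.left] (k : ℕ) :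
    AddSubgroup (Hint X k) where
  carrier := {x | GenericallyTorsion X k x}
  add_mem' := by
    rintro a b ⟨Z₁, hZ₁, hZ₁ne, N₁, hN₁, ha⟩ ⟨Z₂, hZ₂, hZ₂ne, N₂, hN₂, hb⟩
    refine ⟨Z₁ ∪ Z₂, hZ₁.union hZ₂, union_ne_univ hZ₁ hZ₂ hZ₁ne hZ₂ne, N₁ * N₂,
      Nat.one_le_iff_ne_zero.2 (Nat.mul_ne_zero (by omega) (by omega)), ?_⟩
    have ha' : (N₁ * N₂) • res X (Z₁ ∪ Z₂) k a = 0 := by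
      rw [mul_comm, mul_smul, nsmul_res_union_eq_zero_left ha, smul_zero]
    have hb' : (N₁ * N₂) • res X (Z₁ ∪ Z₂) k b = 0 := by
      rw [mul_smul, nsmul_res_union_eq_zero_right hb, smul_zero]
    rw [map_add, smul_add, ha', hb', add_zero]
  zero_mem' := ⟨∅, isClosed_empty, fun h ↦ (Set.empty_ne_univ h).elim, 1, le_rfl,
    by rw [map_zero, smul_zero]⟩
  neg_mem' := by
    rintro a ⟨Z, hZ, hZne, N, hN, ha⟩
    exact ⟨Z, hZ, hZne, N, hN, by rw [map_neg, smul_neg, ha, neg_zero]⟩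

theorem mem_genericallyTorsionAddSubgroup_iff {X : SchemeOver ℂ} [IrreducibleSpace X.left]
    {k : ℕ} {x : Hint X k} : x ∈ genericallyTorsionAddSubgroup X k ↔ GenericallyTorsion X k x :=
  Iff.rfl

/-- `GT` is saturated: `N • x ∈ GT`, `N ≥ 1 ⇒ x ∈ GT`. -/
theorem genericallyTorsion_of_nsmul {X : SchemeOver ℂ} {k N : ℕ} (hN : 1 ≤ N) {x : Hint X k}
    (hx : GenericallyTorsion X k (N • x)) : GenericallyTorsion X k x := by
  obtain ⟨Z, hZ, hZne, N', hN', h⟩ := hx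
  refine ⟨Z, hZ, hZne, N' * N, Nat.one_le_iff_ne_zero.2 (Nat.mul_ne_zero (by omega) (by omega)), ?_⟩
  rwa [map_nsmul, ← mul_smul] at h

/-! ### Proved glue 1b: the bootstrap (formerly `stub_bootstrap`) -/

/-- The inclusion `(X ∖ (Z ∪ Z'))(ℂ) ↪ (X ∖ Z)(ℂ)`, spelled as in `genericDivisibility_restrict_restrict`. -/
abbrev inclL (X : SchemeOver ℂ) (Z Z' : Set X.left) :
    C(complexPointsCompl X (Z ∪ Z'), complexPointsCompl X Z) :=
  ⟨fun P : complexPointsCompl X (Z ∪ Z') =>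
      (⟨P.1, fun hP : P.1.pt ∈ Z => P.2 (Set.subset_union_left hP)⟩ : complexPointsCompl X Z),
    continuous_subtype_val.subtype_mk fun (P : complexPointsCompl X (Z ∪ Z'))
      (hP : P.1.pt ∈ Z) => P.2 (Set.subset_union_left hP)⟩

theorem map_inclL_res {X : SchemeOver ℂ} (Z Z' : Set X.left) (k : ℕ) (z : Hint X k) :
    singularCohomology.map ℤ ℤ (inclL X Z Z') k (res X Z k z) = res X (Z ∪ Z') k z :=
  genericDivisibility_restrict_restrict ℤ Set.subset_union_left k z

/-- **Bootstrap (pure algebra, no Bloch–Kato).** A clean level `s` propagates up the whole `ℓ`-adic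
tower with constant loss `s - 1`: if `D'(ℓ^s, z) ⇒ z ∈ ℓH + GT` for all `z`, then
`D'(ℓ^{n+s}, z) ⇒ z ∈ ℓ^{n+1}H + GT` for all `n` and `z`.  Induction on `n`: from
`M • (z| - ℓ^{n+1+s} y) = 0` and `z = ℓ^{n+1} w₁ + g` (`N • g| = 0` on a second open) get, on the
intersection of the two opens (non-empty: `X` is irreducible),
`M N ℓ^{n+1} • (w₁| - ℓ^s y|) = 0`, i.e. `D'(ℓ^s, w₁)`; cleanness gives `w₁ ∈ ℓ H + GT`, whence
`z ∈ ℓ^{n+2} H + GT` (`GT` is a subgroup). -/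
theorem bootstrap :
    ∀ ⦃p : ℕ⦄ ⦃X : SchemeOver ℂ⦄, 1 ≤ p → IsSmoothProjective (2 * p) X →
      ∀ ℓ s : ℕ, ℓ.Prime → 1 ≤ s → LevelClean ℓ s p X →
        ∀ (n : ℕ) (z : Hint X (2 * p)), DivisibleUpToTorsionOnOpen X (2 * p) (ℓ ^ (n + s)) z →
          ∃ w : Hint X (2 * p), GenericallyTorsion X (2 * p) (z - ℓ ^ (n + 1) • w) := by
  intro p X hp hX ℓ s hℓ hs hclean n
  haveI : IsIntegral X.left := IsSmoothProjective.isIntegral_holds hX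
  induction n with
  | zero =>
    intro z hz
    rw [Nat.zero_add] at hz
    obtain ⟨w, hw⟩ := hclean z hz
    exact ⟨w, by rwa [Nat.zero_add, pow_one]⟩
  | succ n ih =>
    intro z hz
    obtain ⟨Z, hZ, hZne, y, M, hM, hMz⟩ := hz
    -- level `n + s` for `z`, with witness `ℓ • y`
    have hz' : DivisibleUpToTorsionOnOpen X (2 * p) (ℓ ^ (n + s)) z := by
      refine ⟨Z, hZ, hZne, ℓ • y, M, hM, ?_⟩
      rw [← mul_smul, ← pow_succ, show n + s + 1 = n + 1 + s by omega]
      exact hMz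
    obtain ⟨w₁, Z', hZ', hZ'ne, N, hN, hNw⟩ := ih z hz'
    -- transport both relations to the common open `X ∖ (Z ∪ Z')`
    have hA := congrArg (singularCohomology.map ℤ ℤ (inclL X Z Z') (2 * p)) hMz
    rw [map_zero, map_nsmul, map_sub, map_nsmul, map_inclL_res] at hA
    have hB : N • res X (Z ∪ Z') (2 * p) (z - ℓ ^ (n + 1) • w₁) = 0 :=
      nsmul_res_union_eq_zero_right hNw
    rw [map_sub, map_nsmul] at hB
    -- hence `D'(ℓ^s, w₁)` on `X ∖ (Z ∪ Z')` with multiplier `M N ℓ^{n+1}`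
    have hw₁ : DivisibleUpToTorsionOnOpen X (2 * p) (ℓ ^ s) w₁ := by
      refine ⟨Z ∪ Z', hZ.union hZ', union_ne_univ hZ hZ' hZne hZ'ne,
        singularCohomology.map ℤ ℤ (inclL X Z Z') (2 * p) y, M * N * ℓ ^ (n + 1),
        Nat.one_le_iff_ne_zero.2 (Nat.mul_ne_zero (Nat.mul_ne_zero (by omega) (by omega))
          (pow_ne_zero _ hℓ.ne_zero)), ?_⟩
      rw [pow_add] at hA
      have e : (M * N * ℓ ^ (n + 1)) • (res X (Z ∪ Z') (2 * p) w₁ -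
            ℓ ^ s • singularCohomology.map ℤ ℤ (inclL X Z Z') (2 * p) y) =
          N • (M • (res X (Z ∪ Z') (2 * p) z -
            (ℓ ^ (n + 1) * ℓ ^ s) • singularCohomology.map ℤ ℤ (inclL X Z Z') (2 * p) y)) -
          M • (N • (res X (Z ∪ Z') (2 * p) z - ℓ ^ (n + 1) • res X (Z ∪ Z') (2 * p) w₁)) := by
        module
      rw [e, hA, hB, smul_zero, smul_zero, sub_zero]
    obtain ⟨w₂, hw₂⟩ := hclean w₁ hw₁
    refine ⟨w₂, ?_⟩
    have hsum : z - ℓ ^ (n + 1 + 1) • w₂ = (z - ℓ ^ (n + 1) • w₁) + ℓ ^ (n + 1) • (w₁ - ℓ • w₂) := by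
      rw [pow_succ, mul_smul, smul_sub]
      abel
    rw [hsum]
    exact (genericallyTorsionAddSubgroup X (2 * p)).add_mem ⟨Z', hZ', hZ'ne, N, hN, hNw⟩
      ((genericallyTorsionAddSubgroup X (2 * p)).nsmul_mem hw₂ _)

/-! ### Proved glue 2: Krull — `⋂ₙ (ℓ^{n+1} M + S) = S` for a saturated subgroup `S` of a
finitely generated abelian group `M` -/

/-- In a finitely generated abelian group `M`, a SATURATED subgroup `S` (`N • x ∈ S`, `N ≥ 1 ⇒
x ∈ S`) is closed for the `ℓ`-adic topology, `ℓ ≥ 2`: if `z ≡ ℓ^{n+1} wₙ (mod S)` for every `n`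
then `z ∈ S`.  (`M/S` is finitely generated and torsion-free; Krull's intersection theorem for
the proper ideal `(ℓ)` of `ℤ`, Mathlib `Ideal.iInf_pow_smul_eq_bot_of_isTorsionFree`.) -/
theorem mem_of_forall_sub_pow_nsmul_mem {M : Type} [AddCommGroup M] [Module.Finite ℤ M]
    (S : AddSubgroup M) (hsat : ∀ (N : ℕ) (x : M), 1 ≤ N → N • x ∈ S → x ∈ S)
    {ℓ : ℕ} (hℓ : 2 ≤ ℓ) {z : M} (hz : ∀ n : ℕ, ∃ w : M, z - ℓ ^ (n + 1) • w ∈ S) : z ∈ S := by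
  let S' : Submodule ℤ M := AddSubgroup.toIntSubmodule S
  letI : Module ℤ (M ⧸ S') := Submodule.Quotient.module S'
  haveI : Module.Finite ℤ (M ⧸ S') := Module.Finite.quotient ℤ S'
  -- `M/S` is torsion-free because `S` is saturated
  haveI : Module.IsTorsionFree ℤ (M ⧸ S') := by
    refine Module.IsTorsionFree.of_smul_eq_zero fun c q hcq ↦ ?_
    by_cases hc : c = 0
    · exact Or.inl hc
    · right
      induction q using Submodule.Quotient.induction_on with
      | H x =>
        rw [← Submodule.Quotient.mk_smul, Submodule.Quotient.mk_eq_zero] at hcq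
        rw [Submodule.Quotient.mk_eq_zero]
        change c • x ∈ S at hcq
        change x ∈ S
        have hn : 1 ≤ c.natAbs := Nat.one_le_iff_ne_zero.2 (Int.natAbs_ne_zero.2 hc)
        refine hsat c.natAbs x hn ?_
        have h' : (c.natAbs : ℤ) • x ∈ S := by
          rw [← Int.sign_mul_self_eq_natAbs, mul_zsmul]
          exact S.zsmul_mem hcq _
        rwa [natCast_zsmul] at h'
  let I : Ideal ℤ := Ideal.span {(ℓ : ℤ)}
  have hI : I ≠ ⊤ := by
    intro htop
    rw [Ideal.span_singleton_eq_top, Int.isUnit_iff] at htop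
    omega
  have hq : Submodule.Quotient.mk (p := S') z ∈ (⨅ i : ℕ, I ^ i • ⊤ : Submodule ℤ (M ⧸ S')) := by
    refine (Submodule.mem_iInf _).2 fun i ↦ ?_
    obtain ⟨w, hw⟩ := hz i
    have hzw : Submodule.Quotient.mk (p := S') z =
        Submodule.Quotient.mk (p := S') (((ℓ : ℤ) ^ (i + 1)) • w) := by
      rw [eq_comm, ← sub_eq_zero, ← Submodule.Quotient.mk_sub, Submodule.Quotient.mk_eq_zero]
      change (ℓ : ℤ) ^ (i + 1) • w - z ∈ S
      rw [← Int.natCast_pow, natCast_zsmul, ← neg_sub]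
      exact S.neg_mem hw
    rw [hzw, Submodule.Quotient.mk_smul]
    refine Submodule.smul_mono_left (Ideal.pow_le_pow_right (Nat.le_succ i)) ?_
    exact Submodule.smul_mem_smul (Ideal.pow_mem_pow (Ideal.mem_span_singleton_self _) _)
      Submodule.mem_top
  rw [Ideal.iInf_pow_smul_eq_bot_of_isTorsionFree I hI, Submodule.mem_bot,
    Submodule.Quotient.mk_eq_zero] at hq
  exact hq

/-- The same, for `GT ⊆ H^k(X(ℂ);ℤ)` on a smooth projective `X`: if `z ≡ ℓ^{n+1} wₙ (mod GT)` for
every `n` (`ℓ ≥ 2`), then `z ∈ GT` — `H^k(X(ℂ);ℤ)` is finitely generated (tree theorem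
`bettiCohomologyInt_finite_holds`: `X(ℂ)` is a compact manifold) and `GT` is saturated. -/
theorem genericallyTorsion_of_forall_pow {n₀ : ℕ} {X : SchemeOver ℂ} (hX : IsSmoothProjective n₀ X)
    {k ℓ : ℕ} (hℓ : 2 ≤ ℓ) {z : Hint X k}
    (hz : ∀ n : ℕ, ∃ w : Hint X k, GenericallyTorsion X k (z - ℓ ^ (n + 1) • w)) :
    GenericallyTorsion X k z := by
  haveI : IsIntegral X.left := IsSmoothProjective.isIntegral_holds hX
  -- finite generation, transported to the canonical `ℤ`-module structure (all `ℤ`-module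
  -- structures on an abelian group coincide)
  haveI : @Module.Finite ℤ (Hint X k) _ _ (AddCommGroup.toIntModule _) := by
    convert bettiCohomologyInt_finite_holds hX k
    exact Subsingleton.elim _ _
  exact (mem_genericallyTorsionAddSubgroup_iff (X := X)).1
    (mem_of_forall_sub_pow_nsmul_mem (genericallyTorsionAddSubgroup X k)
      (fun N x hN hx ↦ genericallyTorsion_of_nsmul hN hx) hℓ hz)

/-! ### Proved glue 3: `GT ⊗ ℂ ⊆ N¹` -/

/-- A generically-torsion integral class has complexification of coniveau `≥ 1`
(`supportedClasses X k 1`): change of coefficients commutes with restriction, `N` is invertible in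
`ℂ`, and a proper closed subset of the integral scheme `X` has codimension `≥ 1` everywhere. -/
theorem ringChange_mem_supportedClasses_of_genericallyTorsion {n : ℕ} {X : SchemeOver ℂ}
    (hX : IsSmoothProjective n X) {k : ℕ} {x : Hint X k} (hx : GenericallyTorsion X k x) :
    singularCohomology.ringChange (Int.castRingHom ℂ) (ComplexPoints X) k x ∈
      supportedClasses X k 1 := by
  obtain ⟨Z, hZ, hZne, N, hN, h⟩ := hx
  haveI : IsIntegral X.left := IsSmoothProjective.isIntegral_holds hX
  refine mem_supportedClasses_of_restrictCompl_eq_zero hZ (fun z hz ↦ ?_) ?_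
  · -- codimension ≥ 1: the generic point is not in the proper closed `Z`
    rw [Nat.cast_one, Order.one_le_iff_pos, Order.coheight_pos, not_isMax_iff]
    refine ⟨genericPoint X.left, lt_iff_le_not_ge.2 ⟨?_, fun hle ↦ hZne ?_⟩⟩
    · exact Scheme.le_iff_specializes.2 (genericPoint_specializes z)
    · have h1 : genericPoint X.left ∈ Z :=
        hZ.closure_subset_iff.2 (Set.singleton_subset_iff.2 hz)
          (specializes_iff_mem_closure.1 (Scheme.le_iff_specializes.1 hle))
      have h2 : closure ({genericPoint X.left} : Set X.left) ⊆ Z :=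
        hZ.closure_subset_iff.2 (Set.singleton_subset_iff.2 h1)
      rw [genericPoint_closure] at h2
      exact Set.eq_univ_of_univ_subset h2
  · -- `(x ⊗ ℂ)| = (x|) ⊗ ℂ` and `N • (x|) = 0` with `N ≠ 0` in `ℂ`
    change singularCohomology.map ℂ ℂ _ k (singularCohomology.ringChange (Int.castRingHom ℂ) _ k x) = 0
    rw [← genericDivisibility_ringChange_map]
    have h' := congrArg (singularCohomology.ringChange (Int.castRingHom ℂ) (complexPointsCompl X Z) k) h
    rw [map_nsmul, map_zero, ← Nat.cast_smul_eq_nsmul ℂ, smul_eq_zero] at h'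
    exact h'.resolve_left (Nat.cast_ne_zero.2 (by omega))

/-! ### Interface for the crux ideas: the heart at level one from the mod-`ℓ` form -/

/-- Change of coefficients `ℤ → ℤ/ℓ` commutes with pull-back (cocycle-level, as
`genericDivisibility_ringChange_map` for `ℤ → ℂ`; Hatcher §3.1 p. 198). -/
theorem ringChange_zmod_map {S T : Type} [TopologicalSpace S] [TopologicalSpace T] (ℓ : ℕ)
    (f : C(S, T)) (n : ℕ) (x : singularCohomology ℤ ℤ T n) :
    singularCohomology.ringChange (Int.castRingHom (ZMod ℓ)) S n (singularCohomology.map ℤ ℤ f n x) =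
      singularCohomology.map (ZMod ℓ) (ZMod ℓ) f n
        (singularCohomology.ringChange (Int.castRingHom (ZMod ℓ)) T n x) := by
  induction x using singularCohomology_induction_on with
  | h u =>
    rw [singularCohomology.map_π, singularCohomology.ringChange_π, singularCohomology.ringChange_π,
      singularCohomology.map_π]
    congr 1
    refine coFn_injective ?_
    rw [coFn_cocyclesRingChange, coFn_cocyclesMap, coFn_cocyclesMap, coFn_cocyclesRingChange]
    rfl

/-- `ModEllLift ℓ p X` ("mod-`ℓ` coniveau one lifts", `Q(X)[ℓ] = 0`; the k = 2 ideator's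
`ModPrimeConiveauLifts` with the mod-`ℓ` coniveau spelled by ONE non-empty Zariski open): every
integral class whose reduction mod `ℓ` dies on the complex points of some non-empty Zariski open lies
in `ℓ • H²ᵖ(X(ℂ);ℤ) + GT`. -/
def ModEllLift (ℓ p : ℕ) (X : SchemeOver ℂ) : Prop :=
  ∀ z : Hint X (2 * p),
    (∃ Z : Set X.left, IsClosed Z ∧ Z ≠ Set.univ ∧
      singularCohomology.map (ZMod ℓ) (ZMod ℓ)
          (⟨Subtype.val, continuous_subtype_val⟩ : C(complexPointsCompl X Z, ComplexPoints X)) (2 * p)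
          (singularCohomology.ringChange (Int.castRingHom (ZMod ℓ)) (ComplexPoints X) (2 * p) z) = 0) →
    ∃ w : Hint X (2 * p), GenericallyTorsion X (2 * p) (z - ℓ • w)

/-- **The heart at level one from the mod-`ℓ` form**, granted the route's support item
`TorsionDiesGenerically` (Colliot-Thélène–Voisin 2012 Thm 3.1, used once, to drop the torsion `M` of
`D'`): `ModEllLift ℓ p X → LevelClean ℓ 1 p X`. From `M • (z| - ℓ • y) = 0` on `(X ∖ Z)(ℂ)` the
torsion class `z| - ℓ • y` dies on a smaller `(X ∖ Z')(ℂ)`, where therefore `z̄| = ℓ • ȳ| = 0` with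
`ℤ/ℓ`-coefficients. (So the heart with `s = 1` at `ℓ` is the statement `Q(X)[ℓ] = 0` of the ideas
`ordinary-prime-periods` / `galois-rigidity-dichotomy`, modulo CT–V 3.1.) -/
theorem levelClean_one_of_modEllLift (hT : TorsionDiesGenerically) {p : ℕ} {X : SchemeOver ℂ}
    (hp : 1 ≤ p) (hX : IsSmoothProjective (2 * p) X) {ℓ : ℕ} (hlift : ModEllLift ℓ p X) :
    LevelClean ℓ 1 p X := by
  intro z hz
  obtain ⟨Z, hZ, hZne, y, M, hM, hMz⟩ := hz
  obtain ⟨Z', hZZ', hZ'c, hZ'ne, hw⟩ := hT hp hX Z hZ hZne _ M hM hMz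
  refine hlift z ⟨Z', hZ'c, hZ'ne, ?_⟩
  -- on `(X ∖ Z')(ℂ)`: `z| = ℓ • y|`, so the reduction mod `ℓ` of `z|` vanishes
  rw [map_sub, map_nsmul, sub_eq_zero, genericDivisibility_restrict_restrict ℤ hZZ', pow_one] at hw
  rw [← ringChange_zmod_map, hw, map_nsmul, ← Nat.cast_smul_eq_nsmul (ZMod ℓ), ZMod.natCast_self,
    zero_smul]

/-- Hence **`OneCleanPrime`-type input closes the heart**: if every smooth projective `2p`-fold
(`p ≥ 2`) has a prime at which mod-`ℓ` coniveau one lifts, the heart holds with `s = 1` (granted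
`TorsionDiesGenerically`). This is the exact hand-over point for the crux ideas. -/
theorem sig_stub_finiteLevel_of_modEllLift (hT : TorsionDiesGenerically)
    (h : ∀ ⦃p : ℕ⦄ ⦃X : SchemeOver ℂ⦄, 2 ≤ p → IsSmoothProjective (2 * p) X →
      ∃ ℓ : ℕ, ℓ.Prime ∧ ModEllLift ℓ p X) :
    Sig.stub_finiteLevel := by
  rw [sig_stub_finiteLevel_iff]
  intro p X hp hX
  obtain ⟨ℓ, hℓ, hlift⟩ := h hp hX
  exact ⟨ℓ, 1, hℓ, le_rfl, levelClean_one_of_modEllLift hT (by omega) hX hlift⟩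

/-! ### The composition: the stubs imply the crux BY NAME -/

/-- The crux hypothesis (exact divisibility by every `m ≥ 1` on some open) gives `D'(m, z)`. -/
theorem divisibleUpToTorsionOnOpen_of_hyp {X : SchemeOver ℂ} {k : ℕ} {z : Hint X k}
    (hz : ∀ m : ℕ, 1 ≤ m → ∃ Z : Set X.left, IsClosed Z ∧ Z ≠ Set.univ ∧
      ∃ y : singularCohomology ℤ ℤ (complexPointsCompl X Z) k, m • y = res X Z k z)
    {m : ℕ} (hm : 1 ≤ m) : DivisibleUpToTorsionOnOpen X k m z := by
  obtain ⟨Z, hZ, hZne, y, hy⟩ := hz m hm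
  exact ⟨Z, hZ, hZne, y, 1, le_rfl, by rw [one_smul, ← hy, sub_self]⟩

/-- **`finite-level-bootstrap`: the stubs imply `GenericDivisibilityBounded`** (hypotheses are the
stub legends `Sig.stub_*` by name; everything else — bootstrap, finite generation, Krull, bridge —
is proved above). -/
theorem GenericDivisibilityBounded_of_twoStubs :
    Sig.stub_finiteLevel → Sig.stub_surfaceLevelOne → GenericDivisibilityBounded := by
  intro hHeart hSurf
  rw [sig_stub_finiteLevel_iff] at hHeart
  rw [sig_stub_surfaceLevelOne_iff] at hSurf
  unfold Summit.HodgeConjecture.HodgeConjecture.Theses.GenericDivisibility.GenericDivisibilityBounded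
  intro p X hp hX z hz
  -- one clean level at one prime
  obtain ⟨ℓ, s, hℓ, hs, hclean⟩ : ∃ ℓ s : ℕ, ℓ.Prime ∧ 1 ≤ s ∧ LevelClean ℓ s p X := by
    rcases Nat.lt_or_ge p 2 with hp2 | hp2
    · obtain rfl : p = 1 := by omega
      exact ⟨2, 1, Nat.prime_two, le_rfl, hSurf hX 2 Nat.prime_two⟩
    · exact hHeart hp2 hX
  -- the whole tower (bootstrap), then Krull, then the bridge to `N¹ ⊗ ℂ`
  have hall : ∀ n : ℕ, ∃ w : Hint X (2 * p), GenericallyTorsion X (2 * p) (z - ℓ ^ (n + 1) • w) :=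
    fun n ↦ bootstrap hp hX ℓ s hℓ hs hclean n z
      (divisibleUpToTorsionOnOpen_of_hyp hz (Nat.one_le_pow _ _ hℓ.pos))
  exact ringChange_mem_supportedClasses_of_genericallyTorsion hX
    (genericallyTorsion_of_forall_pow hX hℓ.two_le hall)

/-- **`finite-level-bootstrap` after the lead's reshape: the THREE registered stubs imply
`GenericDivisibilityBounded`** — the heart, the topological Thom-degree torsion-freeness and the
surface glue (hypotheses are the stub legends `Sig.stub_*` by name). -/
theorem GenericDivisibilityBounded_of : Sig.stub_finiteLevel → GenericDivisibilityBounded :=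
  fun hHeart ↦ GenericDivisibilityBounded_of_twoStubs hHeart surfaceLevelOne_holds

/-- The three-hypothesis form (heart, topological Thom torsion-freeness, surface glue) — its last two
hypotheses are now theorems (`thomH3TorsionFreeNC_holds`, `surfaceSaturation_of_thomNC_holds`). -/
theorem GenericDivisibilityBounded_of_three :
    Sig.stub_finiteLevel → Sig.stub_thomH3TorsionFreeNC → Sig.stub_surfaceSaturation_of_thomNC →
      GenericDivisibilityBounded :=
  fun hHeart hThom hGlue ↦
    GenericDivisibilityBounded_of_twoStubs hHeart (surfaceLevelOne_of_saturation (hGlue hThom))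

/-- **The crux at `p = 1` (surfaces, degree 2), PROVED — the known case of C2, Hodge-free and now
machine-checked:** an integral class `z ∈ H²(X(ℂ);ℤ)` on a smooth projective complex surface that is
divisible by every `m ≥ 1` on the complex points of some non-empty Zariski open has complexification
of coniveau `≥ 1`. Ingredients: every prime is clean at level one on a surface
(`surfaceLevelOne_holds`, from the landed p145990 + p146835), the bootstrap, Krull on the finitely
generated `H²(X(ℂ);ℤ)/GT`, and `GT ⊗ ℂ ⊆ N¹` (Colliot-Thélène–Voisin 2012 §4.1 in print:
`H²(X;ℤ) ↠ H²_nr(X;ℤ)`). -/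
theorem genericDivisibilityBounded_one :
    ∀ ⦃X : SchemeOver ℂ⦄, IsSmoothProjective (2 * 1) X →
      ∀ z : singularCohomology ℤ ℤ (ComplexPoints X) (2 * 1),
        (∀ m : ℕ, 1 ≤ m → ∃ Z : Set X.left, IsClosed Z ∧ Z ≠ Set.univ ∧
          ∃ y : singularCohomology ℤ ℤ (complexPointsCompl X Z) (2 * 1),
            m • y = singularCohomology.map ℤ ℤ
              (⟨Subtype.val, continuous_subtype_val⟩ : C(complexPointsCompl X Z, ComplexPoints X))
              (2 * 1) z) →
        singularCohomology.ringChange (Int.castRingHom ℂ) (ComplexPoints X) (2 * 1) z ∈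
          supportedClasses X (2 * 1) 1 := by
  intro X hX z hz
  have hclean : LevelClean 2 1 1 X := surfaceLevelOne_holds hX 2 Nat.prime_two
  have hall : ∀ n : ℕ, ∃ w : Hint X (2 * 1), GenericallyTorsion X (2 * 1) (z - 2 ^ (n + 1) • w) :=
    fun n ↦ bootstrap le_rfl hX 2 1 Nat.prime_two le_rfl hclean n z
      (divisibleUpToTorsionOnOpen_of_hyp hz (Nat.one_le_two_pow))
  exact ringChange_mem_supportedClasses_of_genericallyTorsion hX
    (genericallyTorsion_of_forall_pow hX le_rfl hall)

/-! ### Sub-goal (socket) of lead c2, LANDED p154253: C2 at `X` from infinitely many clean primes -/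

/-- **Sub-goal `stub_cruxAtOfInfiniteCleanPrimes` (lead c2, cycle 3), LANDED as p154253
(`Theorems.stub_cruxAtOfInfiniteCleanPrimes` /
`Theorems.genericDivisibilityBounded_at_of_infinite_levelOneClean`; Bloch–Kato-free socket for the
ideas `galois-rigidity-dichotomy` / `ordinary-prime-periods` in their "infinitely many primes"
form).** On a smooth projective `X`, in any degree `k`: if for infinitely many primes `ℓ` every
class divisible by `ℓ` on the complex points of some non-empty Zariski open is congruent to an
`ℓ`-multiple modulo `GT`, then C2 holds at `X` in degree `k` (lattice algebra on the finitely
generated free `H/GT`: a non-zero vector is divisible by finitely many primes only; no bootstrap,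
no Krull, no `TorsionDiesGenerically`). Proved in
`Theorems/GenericDivisibilityGenericDivisibilityBoundedInfinitePrimes.lean`. -/
theorem cruxAtOfInfiniteCleanPrimes_holds :
    ∀ ⦃n₀ : ℕ⦄ ⦃X : SchemeOver ℂ⦄, IsSmoothProjective n₀ X → ∀ (k : ℕ),
      {ℓ : ℕ | ℓ.Prime ∧ ∀ z : singularCohomology ℤ ℤ (ComplexPoints X) k,
        (∃ Z : Set X.left, IsClosed Z ∧ Z ≠ Set.univ ∧
          ∃ y : singularCohomology ℤ ℤ (complexPointsCompl X Z) k,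
            ℓ • y = singularCohomology.map ℤ ℤ
              (⟨Subtype.val, continuous_subtype_val⟩ : C(complexPointsCompl X Z, ComplexPoints X))
              k z) →
        ∃ w : singularCohomology ℤ ℤ (ComplexPoints X) k, ∃ Z : Set X.left, IsClosed Z ∧
          Z ≠ Set.univ ∧ ∃ N : ℕ, 1 ≤ N ∧ N • singularCohomology.map ℤ ℤ
            (⟨Subtype.val, continuous_subtype_val⟩ : C(complexPointsCompl X Z, ComplexPoints X))
            k (z - ℓ • w) = 0}.Infinite →
      ∀ z : singularCohomology ℤ ℤ (ComplexPoints X) k,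
        (∀ m : ℕ, 1 ≤ m → ∃ Z : Set X.left, IsClosed Z ∧ Z ≠ Set.univ ∧
          ∃ y : singularCohomology ℤ ℤ (complexPointsCompl X Z) k,
            m • y = singularCohomology.map ℤ ℤ
              (⟨Subtype.val, continuous_subtype_val⟩ : C(complexPointsCompl X Z, ComplexPoints X))
              k z) →
        singularCohomology.ringChange (Int.castRingHom ℂ) (ComplexPoints X) k z ∈
          supportedClasses X k 1 :=
  fun _ _ hX k hinf z hz ↦
    Summit.HodgeConjecture.HodgeConjecture.Theorems.genericDivisibilityBounded_at_of_infinite_levelOneClean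
      hX k hinf z hz

/-- The mod-`ℓ` form of the same socket (LANDED p154253,
`Theorems.genericDivisibilityBounded_at_of_infinite_modEllLift`), in the line's vocabulary: if
`ModEllLift ℓ p X` holds for infinitely many primes `ℓ` then C2 holds at `X` in degree `2p` —
`FirstLemmaB'` of idea `galois-rigidity-dichotomy`, with no `TorsionDiesGenerically`. -/
theorem cruxAt_of_infinite_modEllLift {p : ℕ} {X : SchemeOver ℂ} (hX : IsSmoothProjective (2 * p) X)
    (hinf : {ℓ : ℕ | ℓ.Prime ∧ ModEllLift ℓ p X}.Infinite) (z : Hint X (2 * p))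
    (hz : ∀ m : ℕ, 1 ≤ m → ∃ Z : Set X.left, IsClosed Z ∧ Z ≠ Set.univ ∧
      ∃ y : singularCohomology ℤ ℤ (complexPointsCompl X Z) (2 * p), m • y = res X Z (2 * p) z) :
    singularCohomology.ringChange (Int.castRingHom ℂ) (ComplexPoints X) (2 * p) z ∈
      supportedClasses X (2 * p) 1 :=
  Summit.HodgeConjecture.HodgeConjecture.Theorems.genericDivisibilityBounded_at_of_infinite_modEllLift
    hX (2 * p) (hinf.mono fun _ hℓ ↦ ⟨hℓ.1, fun z' hz' ↦ hℓ.2 z' hz'⟩) z hz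

/-! ### Sub-goal (socket) of lead c3, LANDED p157362: the Bloch–Srinivas sector -/

/-- **The heart at every prime `ℓ` and every level `s` on the Bloch–Srinivas sector** (LANDED p157362,
`Theorems.genericDivisibilityBounded_levelClean_of_chowRankLEOneUpTo_zero`): on a smooth projective
`2p`-fold (`p ≥ 1`) whose `0`-cycles have `ℚ`-rank `≤ 1`, `LevelClean ℓ s p X` for ALL `ℓ, s` — every
integral middle class is generically torsion off one divisor complement (`w = 0`). So the registered
heart `stub_finiteLevel` is only open on `2p`-folds with `CH₀ ⊗ ℚ` of rank `≥ 2`. -/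
theorem levelClean_of_chowRankLEOneUpTo_zero {p : ℕ} {X : SchemeOver ℂ} (hp : 1 ≤ p)
    (hX : IsSmoothProjective (2 * p) X) (h0 : ChowRankLEOneUpTo X 0) (ℓ s : ℕ) :
    LevelClean ℓ s p X :=
  Summit.HodgeConjecture.HodgeConjecture.Theorems.genericDivisibilityBounded_levelClean_of_chowRankLEOneUpTo_zero
    hX h0 (k := 2 * p) (by omega) ℓ s

/-- **C2 at `X` on the Bloch–Srinivas sector** (LANDED p157362, registered sub-goal
`stub_cruxAtOfChowRankLEOneUpToZero` / `Theorems.genericDivisibilityBounded_at_of_chowRankLEOneUpTo_zero`),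
in the line's vocabulary: every middle class has complexification of coniveau `≥ 1`. -/
theorem cruxAt_of_chowRankLEOneUpTo_zero {p : ℕ} {X : SchemeOver ℂ} (hp : 1 ≤ p)
    (hX : IsSmoothProjective (2 * p) X) (h0 : ChowRankLEOneUpTo X 0) (z : Hint X (2 * p))
    (hz : ∀ m : ℕ, 1 ≤ m → ∃ Z : Set X.left, IsClosed Z ∧ Z ≠ Set.univ ∧
      ∃ y : singularCohomology ℤ ℤ (complexPointsCompl X Z) (2 * p), m • y = res X Z (2 * p) z) :
    singularCohomology.ringChange (Int.castRingHom ℂ) (ComplexPoints X) (2 * p) z ∈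
      supportedClasses X (2 * p) 1 :=
  Summit.HodgeConjecture.HodgeConjecture.Theorems.genericDivisibilityBounded_at_of_chowRankLEOneUpTo_zero
    hp hX h0 z hz

/-! ### Sub-goals (sockets, sectors, structure) of lead c4 — registered stubs, cycle 6

None of these enters the composition `GenericDivisibilityBounded_of` (which needs the heart only);
they are registered so that the wave's Theorems files are recorded on the crux item, and each is
replaced by its landed theorem as it closes. -/

/-- **Sub-goal `stub_heartOfSupportedTop` (lead c4), LANDED p160596
(`Theorems/GenericDivisibilityGenericDivisibilityBoundedSupportedTop`): the heart at every prime `ℓ`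
and level `s` on the sector `N¹H^{2p}(X(ℂ);ℂ) = H^{2p}(X(ℂ);ℂ)`** — `GT = N¹ ∩ H_ℤ`
(`genericDivisibilityBounded_genericallyTorsion_iff_ringChange_mem_supportedClasses`: Bloch–Ogus
directedness, Dimca finiteness, universal coefficients), so `w = 0` works. -/
theorem heartOfSupportedTop_holds :
    ∀ ⦃p : ℕ⦄ ⦃X : SchemeOver ℂ⦄, 1 ≤ p → IsSmoothProjective (2 * p) X →
      supportedClasses X (2 * p) 1 = ⊤ → ∀ ℓ s : ℕ, LevelClean ℓ s p X :=
  fun _ _ hp hX htop ℓ s z hz ↦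
    Summit.HodgeConjecture.HodgeConjecture.Theorems.stub_heartOfSupportedTop hp hX htop ℓ s z hz

/-- `GT = N¹ ∩ H_ℤ` in the line's vocabulary (LANDED p160596): an integral class of degree `2p ≥ 2`
is generically torsion iff its complexification has coniveau `≥ 1`. -/
theorem genericallyTorsion_iff_ringChange_mem_supportedClasses {p : ℕ} {X : SchemeOver ℂ}
    (hp : 1 ≤ p) (hX : IsSmoothProjective (2 * p) X) (z : Hint X (2 * p)) :
    GenericallyTorsion X (2 * p) z ↔
      singularCohomology.ringChange (Int.castRingHom ℂ) (ComplexPoints X) (2 * p) z ∈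
        supportedClasses X (2 * p) 1 :=
  Summit.HodgeConjecture.HodgeConjecture.Theorems.genericDivisibilityBounded_genericallyTorsion_iff_ringChange_mem_supportedClasses
    hX (by omega) z

/-- **Sub-goal `stub_heartOfChowZeroSupportedBelowTop` (lead c4), LANDED p160943
(`Theorems/GenericDivisibilityGenericDivisibilityBoundedChowZeroBelowTop`): the heart at every
`(ℓ, s)` on the sector "`CH₀(X)` supported on a closed algebraic subset of dimension
`≤ d < 2p = dim X`"** (`d = 2p - 1`: supported on a divisor; `d = 0` is c3's Bloch–Srinivas sector):
by the tree theorem `supportedClasses_eq_top_of_hasChowZeroSupportedInDimLE_of_lt` (Bloch–Srinivas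
decomposition of the diagonal + Andreotti–Frankel) such `X` lie in the sector `N¹H^{2p} = H^{2p}`. -/
theorem heartOfChowZeroSupportedBelowTop_holds {p : ℕ} {X : SchemeOver ℂ} (hp : 1 ≤ p)
    (hX : IsSmoothProjective (2 * p) X) {d : ℕ} (hd : d < 2 * p) (hW : HasChowZeroSupportedInDimLE X d)
    (ℓ s : ℕ) : LevelClean ℓ s p X :=
  fun z hz ↦
    Summit.HodgeConjecture.HodgeConjecture.Theorems.stub_heartOfChowZeroSupportedBelowTop hp hX d hd hW
      ℓ s z hz

/-- **Sub-goal `stub_supportedTopOfProduct` (lead c4), LANDED p160876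
(`Theorems/GenericDivisibilityGenericDivisibilityBoundedSupportedTopOfProduct`, wave-1 worker):
Künneth — if ONE factor has all of its middle cohomology of coniveau `≥ 1`, the product has
`N¹H^{a+b}((V ⊗ V')(ℂ);ℂ) = H^{a+b}`** (`kunnethSpan_complexBetti`, exterior products add coniveaux,
degrees above the dimension have coniveau `≥ 1`). Corollaries landed in the same file: the mirror
form, and `…_supportedClasses_tensor_two_mul_eq_top_of_pg_zero` — `S ⊗ Y` with `p_g(S) = 0`
(Lefschetz (1,1)), `Y` ANY smooth projective `(2p-2)`-fold, e.g. `Enriques ⊗ K3` (CH₀ large). -/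
theorem supportedTopOfProduct_holds :
    ∀ ⦃a b : ℕ⦄ ⦃V V' : SchemeOver ℂ⦄, IsSmoothProjective a V → IsSmoothProjective b V' →
      supportedClasses V a 1 = ⊤ → supportedClasses (V ⊗ V') (a + b) 1 = ⊤ :=
  Summit.HodgeConjecture.HodgeConjecture.Theorems.stub_supportedTopOfProduct

/-- **The heart at every `(ℓ, s)` on `S ⊗ Y`, `S` a surface with `p_g = 0`, `Y` any smooth
projective `(2p-2)`-fold** (p160876 + p160596): the first sector of the heart with `CH₀`
infinite-dimensional (`Y = K3 × …`). -/
theorem levelClean_tensor_of_pg_zero {p : ℕ} (hp : 1 ≤ p) {S Y : SchemeOver ℂ}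
    (hS : IsSmoothProjective 2 S) (hpg : ∃ A : HodgeModel 2 S, Module.finrank ℂ ↥(A.hodgePQ 2 2 0) = 0)
    (hY : IsSmoothProjective (2 * p - 2) Y) (ℓ s : ℕ) : LevelClean ℓ s p (S ⊗ Y) := by
  have hSY : IsSmoothProjective (2 * p) (S ⊗ Y) := by
    have h := IsSmoothProjective.tensor_holds hS hY
    rwa [show 2 + (2 * p - 2) = 2 * p by omega] at h
  exact heartOfSupportedTop_holds hp hSY
    (Summit.HodgeConjecture.HodgeConjecture.Theorems.genericDivisibilityBounded_supportedClasses_tensor_two_mul_eq_top_of_pg_zero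
      hp hS hpg hY) ℓ s

/-- **Sub-goal `stub_cruxAtOfSurjective` (lead c4), LANDED p160936
(`Theorems/GenericDivisibilityGenericDivisibilityBoundedCruxAtOfSurjective`, wave-1 worker): C2
DESCENDS along surjective morphisms of smooth projective `2p`-folds** (pull the witnesses back, push
coniveau down: `x = c⁻¹ f_* f^* x`); same file: `genericDivisibilityBounded_at_of_isBirational` —
C2 at any smooth birational model of `X` gives C2 at `X` (idea `birational-snc-descent`, first
lemma, descending direction). -/
theorem cruxAtOfSurjective_holds :
    ∀ ⦃p : ℕ⦄ ⦃X' X : SchemeOver ℂ⦄ (f : X' ⟶ X), 1 ≤ p → IsSmoothProjective (2 * p) X' →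
      IsSmoothProjective (2 * p) X → Function.Surjective f.left.base →
      (∀ z' : singularCohomology ℤ ℤ (ComplexPoints X') (2 * p),
        (∀ m : ℕ, 1 ≤ m → ∃ Z : Set X'.left, IsClosed Z ∧ Z ≠ Set.univ ∧
          ∃ y : singularCohomology ℤ ℤ (complexPointsCompl X' Z) (2 * p), m • y = res X' Z (2 * p) z') →
        singularCohomology.ringChange (Int.castRingHom ℂ) (ComplexPoints X') (2 * p) z' ∈
          supportedClasses X' (2 * p) 1) →
      ∀ z : singularCohomology ℤ ℤ (ComplexPoints X) (2 * p),
        (∀ m : ℕ, 1 ≤ m → ∃ Z : Set X.left, IsClosed Z ∧ Z ≠ Set.univ ∧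
          ∃ y : singularCohomology ℤ ℤ (complexPointsCompl X Z) (2 * p), m • y = res X Z (2 * p) z) →
        singularCohomology.ringChange (Int.castRingHom ℂ) (ComplexPoints X) (2 * p) z ∈
          supportedClasses X (2 * p) 1 :=
  Summit.HodgeConjecture.HodgeConjecture.Theorems.stub_cruxAtOfSurjective

/-- **Sub-goal `stub_genericallyDivisibleIffFunctionField` (lead c4), LANDED p160865
(`Theorems/GenericDivisibilityGenericDivisibilityBoundedFunctionField`, wave-1 worker): the crux
hypothesis at `m` is divisibility by `m` of the generic restriction
`z_η ∈ H^k(ℂ(X); ℤ) = functionFieldCohomology ℤ X k`** (Bloch–Ogus (3.9): a germ comes from a stage,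
equal germs agree on a smaller non-empty open). So C2 at `X` reads
`E ∩ ⋂ₘ m · H^{2p}(ℂ(X);ℤ) ⊆ image of GT`, `E = im(H^{2p}(X(ℂ);ℤ) → H^{2p}(ℂ(X);ℤ))`. -/
theorem genericallyDivisibleIffFunctionField_holds :
    ∀ ⦃X : SchemeOver ℂ⦄ [IrreducibleSpace X.left] (k : ℕ) (z : Hint X k) (m : ℕ),
      (∃ Z : Set X.left, IsClosed Z ∧ Z ≠ Set.univ ∧
        ∃ y : singularCohomology ℤ ℤ (complexPointsCompl X Z) k, m • y = res X Z k z) ↔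
      ∃ y : functionFieldCohomology ℤ X k, m • y = toFunctionField ℤ X k z :=
  fun _ _ k z m ↦
    Summit.HodgeConjecture.HodgeConjecture.Theorems.stub_genericallyDivisibleIffFunctionField k z m

/-! ### Sub-goals of lead c4 registered via `stub-add` and LANDED (structure and instances) -/

/-- **Sub-goal `stub_heartIffBoundedLoss` (lead c4), LANDED p161788
(`Theorems/GenericDivisibilityGenericDivisibilityBoundedHeartStructure`): the heart at `ℓ` ⟺ BOUNDED
`ℓ`-ADIC LOSS** — some level `ℓ^s` is clean iff for some `s ≥ 1` and every `n`,
`D'(ℓ^{n+s}, z) ⇒ ∃ w, z - ℓ^{n+1} • w ∈ GT` (→ bootstrap, ← `n = 0`). Same file: level monotonicity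
(`LevelClean ℓ s → LevelClean ℓ s'`, `s ≤ s'`), integral coniveau `⊆ GT`, and the `N¹ = ⊤` sector is
inherited by every variety DOMINATED (surjective, equidimensional) by an `N¹ = ⊤` one. -/
theorem heartIffBoundedLoss_holds {p : ℕ} {X : SchemeOver ℂ}
    (hX : IsSmoothProjective (2 * p) X) {ℓ : ℕ} (hℓ : 1 ≤ ℓ) :
    (∃ s : ℕ, 1 ≤ s ∧ LevelClean ℓ s p X) ↔
      ∃ s : ℕ, 1 ≤ s ∧ ∀ (n : ℕ) (z : Hint X (2 * p)),
        DivisibleUpToTorsionOnOpen X (2 * p) (ℓ ^ (n + s)) z →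
          ∃ w : Hint X (2 * p), GenericallyTorsion X (2 * p) (z - ℓ ^ (n + 1) • w) :=
  Summit.HodgeConjecture.HodgeConjecture.Theorems.stub_heartIffBoundedLoss hX (2 * p) ℓ hℓ

/-- Level monotonicity of the heart (LANDED p161788): a clean level stays clean higher up. -/
theorem levelClean_mono {p : ℕ} {X : SchemeOver ℂ} {ℓ s s' : ℕ} (hss' : s ≤ s')
    (h : LevelClean ℓ s p X) : LevelClean ℓ s' p X :=
  Summit.HodgeConjecture.HodgeConjecture.Theorems.genericDivisibilityBounded_levelClean_mono hss' h

/-- **Sub-goal `stub_heartOfCoveredByRationalCurves` (lead c4), LANDED p161921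
(`Theorems/GenericDivisibilityGenericDivisibilityBoundedRationalCurves`): the heart at every `(ℓ, s)`
on smooth projective `2p`-folds COVERED BY RATIONAL CURVES** (uniruled: `CH₀` on a hyperplane section,
Voisin II remark after Prop. 10.26, then the divisor sector p160943); same file: smooth hypersurfaces
of degree `≤ 2p` in `ℙ^{2p+1}`, and C2 in both cases. -/
theorem heartOfCoveredByRationalCurves_holds {p : ℕ} {X : SchemeOver ℂ} (hp : 1 ≤ p)
    (hX : IsSmoothProjective (2 * p) X)
    (hcov : ∀ x : ↥X.left, Order.height x = 0 → ∃ ν : projectiveSpace 1 ℂ ⟶ X,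
      x ∈ Set.range ν.left.base ∧ ¬ ∀ a b, ν.left.base a = ν.left.base b) (ℓ s : ℕ) :
    LevelClean ℓ s p X :=
  fun z hz ↦
    Summit.HodgeConjecture.HodgeConjecture.Theorems.stub_heartOfCoveredByRationalCurves hp hX hcov ℓ s z hz

/-- **Sub-goal `stub_cruxOfOneCleanPrimeOffSupportedTop` (lead c4), LANDED p162249
(`Theorems/GenericDivisibilityGenericDivisibilityBoundedOffSupportedTop`): the SHARPEST consumer of the
heart** — `GenericDivisibilityBounded` follows from one clean prime and level on every smooth
projective `2p`-fold (`p ≥ 2`) CARRYING A MIDDLE CLASS OF CONIVEAU `0`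
(`supportedClasses X (2 * p) 1 ≠ ⊤`; granted GHC, `h^{2p,0} ≠ 0`). In the line's vocabulary: -/
theorem GenericDivisibilityBounded_of_offSupportedTop
    (hHeart : ∀ ⦃p : ℕ⦄ ⦃X : SchemeOver ℂ⦄, 2 ≤ p → IsSmoothProjective (2 * p) X →
      supportedClasses X (2 * p) 1 ≠ ⊤ → ∃ ℓ s : ℕ, ℓ.Prime ∧ 1 ≤ s ∧ LevelClean ℓ s p X) :
    GenericDivisibilityBounded :=
  Summit.HodgeConjecture.HodgeConjecture.Theorems.stub_cruxOfOneCleanPrimeOffSupportedTop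
    fun _ _ hp hX htop ↦ hHeart hp hX htop

/-- **Sub-goal `stub_cruxAtIffFunctionField` (lead c4), LANDED p162355
(`Theorems/GenericDivisibilityGenericDivisibilityBoundedFunctionFieldForms`): C2 at `X` ENTIRELY AT
THE GENERIC POINT** — with `ρ = toFunctionField ℤ X (2p) : H^{2p}(X(ℂ);ℤ) → H^{2p}(ℂ(X);ℤ)`:
the crux at `X` ⟺ "`ρ z` divisible by every `m ≥ 1` ⇒ `ρ (N • z) = 0` for some `N ≥ 1`", i.e.
`ρ⁻¹(⋂ₘ m·H_η) ⊆ ρ⁻¹(tors) = GT` (same file: `GT = ρ⁻¹(torsion)`); granted CT–V torsion-freeness,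
`im ρ ∩ div H_η = 0`. -/
theorem cruxAt_iff_functionField {p : ℕ} {X : SchemeOver ℂ} [IrreducibleSpace X.left] (hp : 1 ≤ p)
    (hX : IsSmoothProjective (2 * p) X) :
    (∀ z : Hint X (2 * p),
      (∀ m : ℕ, 1 ≤ m → ∃ Z : Set X.left, IsClosed Z ∧ Z ≠ Set.univ ∧
        ∃ y : singularCohomology ℤ ℤ (complexPointsCompl X Z) (2 * p), m • y = res X Z (2 * p) z) →
      singularCohomology.ringChange (Int.castRingHom ℂ) (ComplexPoints X) (2 * p) z ∈
        supportedClasses X (2 * p) 1) ↔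
    (∀ z : Hint X (2 * p),
      (∀ m : ℕ, 1 ≤ m → ∃ y : functionFieldCohomology ℤ X (2 * p), m • y = toFunctionField ℤ X (2 * p) z) →
      ∃ N : ℕ, 1 ≤ N ∧ toFunctionField ℤ X (2 * p) (N • z) = 0) :=
  Summit.HodgeConjecture.HodgeConjecture.Theorems.stub_cruxAtIffFunctionField hX (2 * p) (by omega)

/-! ### Sub-goals `stub_levelDivisibleIffFunctionField` / `stub_levelCleanIffFunctionField` (lead c4, wave 3), LANDED p163474

`Theorems/GenericDivisibilityGenericDivisibilityBoundedHeartFunctionField` (import it to use; not imported here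
only because the farm had not yet built the module when this workfile was last published): `D'(m, z)` and the
HEART at `(ℓ, s, X)` ENTIRELY AT THE GENERIC POINT — with `ρ = toFunctionField ℤ X (2p)`:
`D'(m, z) ⟺ ∃ f M, M • (ρ z - m • f) = 0`, and
`LevelClean ℓ s p X ⟺ ∀ z, (∃ f M, M • (ρ z - ℓ^s • f) = 0) → ∃ w N, ρ (N • (z - ℓ • w)) = 0`.
The one-line re-export for the next lead:
```
theorem levelClean_iff_functionField {p : ℕ} {X : SchemeOver ℂ} [IrreducibleSpace X.left] (ℓ s : ℕ) :
    LevelClean ℓ s p X ↔ ∀ z : Hint X (2 * p),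
      (∃ (f : functionFieldCohomology ℤ X (2 * p)) (M : ℕ), 1 ≤ M ∧
        M • (toFunctionField ℤ X (2 * p) z - ℓ ^ s • f) = 0) →
      ∃ (w : Hint X (2 * p)) (N : ℕ), 1 ≤ N ∧ toFunctionField ℤ X (2 * p) (N • (z - ℓ • w)) = 0 :=
  Summit.HodgeConjecture.HodgeConjecture.Theorems.stub_levelCleanIffFunctionField (2 * p) ℓ s
```
-/

/-! ### Sub-goals of lead c4, wave 2: transport of the HEART and of C2 along morphisms -/

/-- **Sub-goal `stub_heartOfHasDegreeCoprime` (lead c4, wave 2), LANDED p162684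
(`Theorems/GenericDivisibilityGenericDivisibilityBoundedHeartDescent`, wave-2 worker): the heart
DESCENDS along surjective morphisms of degree prime to `ℓ`.** For `f : X' ⟶ X` surjective between
smooth projective `2p`-folds, of degree `d` for integral orientations `μ`, `ν` of `X'(ℂ)`, `X(ℂ)`, and
`gcd(ℓ, d) = 1`: level `ℓ^s` clean at `X'` ⇒ level `ℓ^s` clean at `X` (pull `D'(ℓ^s, z)` back; heart
upstairs; INTEGRAL Gysin `f_!` with `f_! f^* = d` and `f_!(GT(X')) ⊆ GT(X)` — `(f_! u) ⊗ ℂ = c • f_!(u ⊗ ℂ)`,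
`c ≠ 0`, Gysin images keep coniveau, `GT = N¹ ∩ H_ℤ`; Bézout). The registered signature spells the
degree hypothesis `HasDegree μ ν (AlgPoints.mapContinuous f) d` (no named universe argument: the
skeleton checker truncates signatures at `:=`). -/
theorem heartOfHasDegreeCoprime_holds :
    ∀ ⦃p : ℕ⦄ ⦃X' X : SchemeOver ℂ⦄ (f : X' ⟶ X)
      (μ : HomologicalOrientation ℤ (ComplexPoints X') (2 * (2 * p)))
      (ν : HomologicalOrientation ℤ (ComplexPoints X) (2 * (2 * p))) (d : ℤ),
      1 ≤ p → IsSmoothProjective (2 * p) X' → IsSmoothProjective (2 * p) X →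
      HasDegree μ ν (AlgPoints.mapContinuous f) d → Function.Surjective f.left.base →
      ∀ ℓ s : ℕ, IsCoprime (ℓ : ℤ) d → LevelClean ℓ s p X' → LevelClean ℓ s p X :=
  fun _ _ _ f μ ν d hp hX' hX hdeg hf ℓ s hcop hC z hz ↦
    Summit.HodgeConjecture.HodgeConjecture.Theorems.stub_heartOfHasDegreeCoprime f μ ν d hp hX' hX hdeg
      hf ℓ s hcop hC z hz

/-- **The heart descends from any smooth projective birational model** (p162684, `d = 1`,
`hasDegree_one_complexOrientationInt_of_isBirational`): for `σ : X' ⟶ X` birational between smooth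
projective `2p`-folds, `LevelClean ℓ s p X' → LevelClean ℓ s p X` for EVERY `ℓ, s`. So the heart
`stub_finiteLevel` at `X` may be proved on any blow-up / embedded-resolution model of `X`
(idea `birational-snc-descent`: witnesses may be taken simple-normal-crossing). -/
theorem levelClean_of_isBirational {p : ℕ} {X' X : SchemeOver ℂ} (σ : X' ⟶ X) (hp : 1 ≤ p)
    (hX' : IsSmoothProjective (2 * p) X') (hX : IsSmoothProjective (2 * p) X)
    (hσ : Literature.AlgebraicGeometry.Resolution.IsBirational σ.left) (ℓ s : ℕ)
    (hC : LevelClean ℓ s p X') : LevelClean ℓ s p X :=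
  fun z hz ↦
    Summit.HodgeConjecture.HodgeConjecture.Theorems.genericDivisibilityBounded_levelClean_of_isBirational
      σ hX' hX hσ (k := 2 * p) (q := 2 * p) (by omega) (by omega) ℓ s hC z hz

/-- **Sub-goal `stub_cruxAtOfBirationalUp` (lead c4, wave 2), LANDED p162489
(`Theorems/GenericDivisibilityGenericDivisibilityBoundedBirationalUp`, wave-2 worker): C2 ASCENDS
along birational morphisms** — with `cruxAtOfSurjective_holds` (p160936,
`genericDivisibilityBounded_at_of_isBirational`) this makes **C2 at `X` a BIRATIONAL INVARIANT of the
smooth projective `2p`-fold `X`** (idea `birational-snc-descent`, first lemma `c2At_birational_invariant`;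
CT–Voisin 2012 Thm. 2.8 (iii) / Prop. 3.4 for `H_nr`, here the crux itself on the tree's carriers).
Route: `ker σ_*` dies on the isomorphism locus (`…_restrictCompl_eq_zero_of_gysinMap_eq_zero`, from the
tree's `exists_restrictCompl_sub_map_eq_zero_of_isIso_restrict` + `gysinMap_restrictCompl_eq_zero_of_field`;
ℤ-Gysin-killed ⇒ ℂ-Gysin-killed, `…_gysinMap_ringChange_eq_zero`), so `z̃ - σ^*(σ_! z̃) ∈ GT(X̃)`;
transport the divisibility of `N • σ^* σ_! z̃` down over the iso locus (`…_exists_homeomorph_compl`),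
apply C2 at `X`, pull back. -/
theorem cruxAtOfBirationalUp_holds :
    ∀ ⦃p : ℕ⦄ ⦃X' X : SchemeOver ℂ⦄ (σ : X' ⟶ X), 1 ≤ p → IsSmoothProjective (2 * p) X' →
      IsSmoothProjective (2 * p) X → Literature.AlgebraicGeometry.Resolution.IsBirational σ.left →
      (∀ z : singularCohomology ℤ ℤ (ComplexPoints X) (2 * p),
        (∀ m : ℕ, 1 ≤ m → ∃ Z : Set X.left, IsClosed Z ∧ Z ≠ Set.univ ∧
          ∃ y : singularCohomology ℤ ℤ (complexPointsCompl X Z) (2 * p), m • y = res X Z (2 * p) z) →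
        singularCohomology.ringChange (Int.castRingHom ℂ) (ComplexPoints X) (2 * p) z ∈
          supportedClasses X (2 * p) 1) →
      ∀ z' : singularCohomology ℤ ℤ (ComplexPoints X') (2 * p),
        (∀ m : ℕ, 1 ≤ m → ∃ Z : Set X'.left, IsClosed Z ∧ Z ≠ Set.univ ∧
          ∃ y : singularCohomology ℤ ℤ (complexPointsCompl X' Z) (2 * p), m • y = res X' Z (2 * p) z') →
        singularCohomology.ringChange (Int.castRingHom ℂ) (ComplexPoints X') (2 * p) z' ∈
          supportedClasses X' (2 * p) 1 :=
  Summit.HodgeConjecture.HodgeConjecture.Theorems.stub_cruxAtOfBirationalUp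

/-- **C2 at `X` is a birational invariant** (p160936 + p162489): for `σ : X' ⟶ X` birational between
smooth projective `2p`-folds, C2 at `X` ⟺ C2 at `X'`. -/
theorem cruxAt_iff_of_isBirational {p : ℕ} {X' X : SchemeOver ℂ} (σ : X' ⟶ X) (hp : 1 ≤ p)
    (hX' : IsSmoothProjective (2 * p) X') (hX : IsSmoothProjective (2 * p) X)
    (hσ : Literature.AlgebraicGeometry.Resolution.IsBirational σ.left) :
    (∀ z : Hint X (2 * p),
      (∀ m : ℕ, 1 ≤ m → ∃ Z : Set X.left, IsClosed Z ∧ Z ≠ Set.univ ∧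
        ∃ y : singularCohomology ℤ ℤ (complexPointsCompl X Z) (2 * p), m • y = res X Z (2 * p) z) →
      singularCohomology.ringChange (Int.castRingHom ℂ) (ComplexPoints X) (2 * p) z ∈
        supportedClasses X (2 * p) 1) ↔
    (∀ z' : Hint X' (2 * p),
      (∀ m : ℕ, 1 ≤ m → ∃ Z : Set X'.left, IsClosed Z ∧ Z ≠ Set.univ ∧
        ∃ y : singularCohomology ℤ ℤ (complexPointsCompl X' Z) (2 * p), m • y = res X' Z (2 * p) z') →
      singularCohomology.ringChange (Int.castRingHom ℂ) (ComplexPoints X') (2 * p) z' ∈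
        supportedClasses X' (2 * p) 1) :=
  ⟨cruxAtOfBirationalUp_holds σ hp hX' hX hσ,
    fun hC z hz ↦
      Summit.HodgeConjecture.HodgeConjecture.Theorems.genericDivisibilityBounded_at_of_isBirational
        σ hX' hX hσ (2 * p) hC z hz⟩


/-! ### Sub-goals of lead c5 (cycle 7): the HEART and the N¹-top sector ASCEND along birational morphisms;
the heart at one prime is a BOUNDED-EXPONENT statement at the generic point

Registered sub-goal stubs of this cycle — ALL LANDED in wave 1 (p167622, p167882, p168112); signatures def-free, no `:=` token:
* `stub_heartOfBirationalUp` — for `σ : X' ⟶ X` birational between smooth projective `2p`-folds and ANY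
  `ℓ, s`: `LevelClean ℓ s p X → LevelClean ℓ s p X'`. With the landed descent (p162684,
  `levelClean_of_isBirational`) **the heart at `(ℓ, s)` is a BIRATIONAL INVARIANT** — closing HEART-c4 §E's
  debt WITHOUT the integral blow-up formula: `ker σ_! ⊆ GT(X')` is landed (p162489:
  `genericDivisibilityBounded_restrictCompl_eq_zero_of_gysinMap_eq_zero` + `…_gysinMap_ringChange_eq_zero`
  + `GT = N¹ ∩ H_ℤ`), so `z' ≡ σ^*(σ_! z') mod GT(X')`; `D'(ℓ^s, ·)` is invariant mod `GT` and transports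
  DOWN over the iso locus (`genericDivisibilityBounded_exists_homeomorph_compl`) to `D'(ℓ^s, σ_! z')` on `X`;
  the heart at `X` gives `σ_! z' - ℓ • w ∈ GT(X)`; pull back (`σ` onto: `σ^* GT(X) ⊆ GT(X')`).
* `stub_supportedTopOfBirationalUp` — `supportedClasses X k 1 = ⊤ → supportedClasses X' k 1 = ⊤` for
  `σ : X' ⟶ X` birational between smooth projective `n`-folds, `1 ≤ k`, `k + q = 2n`: same splitting over `ℂ`
  (`x' = σ^*(σ_! x') + κ`, `σ_! κ = 0`, `κ` dies on the iso locus; `σ^*` keeps coniveau for `σ` onto). With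
  p161788 (`…_supportedClasses_eq_top_of_surjective`) **the N¹-top sector 𝒮 — the exact locus where the heart
  and C2 are settled — is a birational invariant**.
* `stub_levelCleanIffBoundedGenericTorsion` — pure algebra over p163474 (`stub_levelCleanIffFunctionField`):
  with `ρ = toFunctionField ℤ X k`, for `1 ≤ ℓ` and every `a`,
  `LevelClean ℓ (a+1) ⟺ ∀ f r, (∃ z M ≥ 1, M • (ρ z - ℓ^r • f) = 0) → ∃ w N ≥ 1, N • (ρ w - ℓ^a • f) = 0`:
  **level `ℓ^{a+1}` is clean iff the `ℓ`-primary torsion of `H^k(ℂ(X);ℤ)/im ρ` (modulo the torsion of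
  `H^k(ℂ(X);ℤ)`, which is zero by CT–Voisin 3.1) is killed by `ℓ^a`** — the refuters' computable form
  (HEART-c2 §B, Disproof.lean §2) as an unconditional Theorems record; (⇒) by descending induction on `r`
  (one application of `LevelClean` lowers `r` by one, the multiplier absorbing `ℓ`), (⇐) directly. -/

/-- **Sub-goal `stub_heartOfBirationalUp` (lead c5), LANDED p167622 (`Theorems/…HeartBirationalUp`, wave-1 worker): the heart ASCENDS along birational morphisms.** For `σ : X' ⟶ X`
birational between smooth projective `2p`-folds (`p ≥ 1`) and any `ℓ, s`: level `ℓ^s` clean at `X`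
implies level `ℓ^s` clean at `X'`. -/
theorem stub_heartOfBirationalUp :
    ∀ ⦃p : ℕ⦄ ⦃X' X : SchemeOver ℂ⦄ (σ : X' ⟶ X), 1 ≤ p → IsSmoothProjective (2 * p) X' →
      IsSmoothProjective (2 * p) X → Literature.AlgebraicGeometry.Resolution.IsBirational σ.left →
      ∀ ℓ s : ℕ,
      (∀ z : singularCohomology ℤ ℤ (ComplexPoints X) (2 * p),
        (∃ Z : Set X.left, IsClosed Z ∧ Z ≠ Set.univ ∧
          ∃ (y : singularCohomology ℤ ℤ (complexPointsCompl X Z) (2 * p)) (M : ℕ), 1 ≤ M ∧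
            M • (singularCohomology.map ℤ ℤ
              (⟨Subtype.val, continuous_subtype_val⟩ : C(complexPointsCompl X Z, ComplexPoints X))
              (2 * p) z - ℓ ^ s • y) = 0) →
        ∃ w : singularCohomology ℤ ℤ (ComplexPoints X) (2 * p),
          ∃ Z : Set X.left, IsClosed Z ∧ Z ≠ Set.univ ∧ ∃ N : ℕ, 1 ≤ N ∧
            N • singularCohomology.map ℤ ℤ
              (⟨Subtype.val, continuous_subtype_val⟩ : C(complexPointsCompl X Z, ComplexPoints X))
              (2 * p) (z - ℓ • w) = 0) →
      ∀ z' : singularCohomology ℤ ℤ (ComplexPoints X') (2 * p),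
        (∃ Z : Set X'.left, IsClosed Z ∧ Z ≠ Set.univ ∧
          ∃ (y : singularCohomology ℤ ℤ (complexPointsCompl X' Z) (2 * p)) (M : ℕ), 1 ≤ M ∧
            M • (singularCohomology.map ℤ ℤ
              (⟨Subtype.val, continuous_subtype_val⟩ : C(complexPointsCompl X' Z, ComplexPoints X'))
              (2 * p) z' - ℓ ^ s • y) = 0) →
        ∃ w : singularCohomology ℤ ℤ (ComplexPoints X') (2 * p),
          ∃ Z : Set X'.left, IsClosed Z ∧ Z ≠ Set.univ ∧ ∃ N : ℕ, 1 ≤ N ∧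
            N • singularCohomology.map ℤ ℤ
              (⟨Subtype.val, continuous_subtype_val⟩ : C(complexPointsCompl X' Z, ComplexPoints X'))
              (2 * p) (z' - ℓ • w) = 0 :=
  Summit.HodgeConjecture.HodgeConjecture.Theorems.stub_heartOfBirationalUp

/-- **Sub-goal `stub_supportedTopOfBirationalUp` (lead c5), LANDED p167882 (`Theorems/…SupportedTopBirationalUp`, wave-1 worker): the N¹-top sector ascends along birational morphisms.** For
`σ : X' ⟶ X` birational between smooth projective `n`-folds, `1 ≤ k`, `k + q = 2n`:
`supportedClasses X k 1 = ⊤ → supportedClasses X' k 1 = ⊤`. -/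
theorem stub_supportedTopOfBirationalUp :
    ∀ ⦃n : ℕ⦄ ⦃X' X : SchemeOver ℂ⦄ (σ : X' ⟶ X), IsSmoothProjective n X' → IsSmoothProjective n X →
      Literature.AlgebraicGeometry.Resolution.IsBirational σ.left →
      ∀ k q : ℕ, 1 ≤ k → k + q = 2 * n → supportedClasses X k 1 = ⊤ → supportedClasses X' k 1 = ⊤ :=
  Summit.HodgeConjecture.HodgeConjecture.Theorems.stub_supportedTopOfBirationalUp

/-- **Sub-goal `stub_levelCleanIffBoundedGenericTorsion` (lead c5), LANDED p168112 (`Theorems/…BoundedGenericTorsion`, wave-1 worker): a clean level is a bounded exponent at the generic point.** For `X`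
irreducible, any degree `k`, `1 ≤ ℓ` and any `a`, with `ρ = toFunctionField ℤ X k`: level `ℓ^(a+1)` is
clean in degree `k` iff every generic class `f` some `ℓ`-power multiple of which lies in `im ρ` up to
torsion has `ℓ^a • f ∈ im ρ` up to torsion. -/
theorem stub_levelCleanIffBoundedGenericTorsion :
    ∀ ⦃X : SchemeOver ℂ⦄ [IrreducibleSpace X.left] (k ℓ a : ℕ), 1 ≤ ℓ →
      ((∀ z : singularCohomology ℤ ℤ (ComplexPoints X) k,
          (∃ Z : Set X.left, IsClosed Z ∧ Z ≠ Set.univ ∧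
            ∃ (y : singularCohomology ℤ ℤ (complexPointsCompl X Z) k) (M : ℕ), 1 ≤ M ∧
              M • (singularCohomology.map ℤ ℤ
                (⟨Subtype.val, continuous_subtype_val⟩ : C(complexPointsCompl X Z, ComplexPoints X))
                k z - ℓ ^ (a + 1) • y) = 0) →
          ∃ w : singularCohomology ℤ ℤ (ComplexPoints X) k,
            ∃ Z : Set X.left, IsClosed Z ∧ Z ≠ Set.univ ∧ ∃ N : ℕ, 1 ≤ N ∧
              N • singularCohomology.map ℤ ℤ
                (⟨Subtype.val, continuous_subtype_val⟩ : C(complexPointsCompl X Z, ComplexPoints X))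
                k (z - ℓ • w) = 0) ↔
        (∀ (f : functionFieldCohomology ℤ X k) (r : ℕ),
          (∃ (z : singularCohomology ℤ ℤ (ComplexPoints X) k) (M : ℕ), 1 ≤ M ∧
              M • (toFunctionField ℤ X k z - ℓ ^ r • f) = 0) →
          ∃ (w : singularCohomology ℤ ℤ (ComplexPoints X) k) (N : ℕ), 1 ≤ N ∧
              N • (toFunctionField ℤ X k w - ℓ ^ a • f) = 0)) :=
  Summit.HodgeConjecture.HodgeConjecture.Theorems.stub_levelCleanIffBoundedGenericTorsion

/-- **The heart at `(ℓ, s)` is a birational invariant** (descent p162684 + ascent `stub_heartOfBirationalUp`):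
for `σ : X' ⟶ X` birational between smooth projective `2p`-folds, `LevelClean ℓ s p X' ↔ LevelClean ℓ s p X`. -/
theorem levelClean_iff_of_isBirational {p : ℕ} {X' X : SchemeOver ℂ} (σ : X' ⟶ X) (hp : 1 ≤ p)
    (hX' : IsSmoothProjective (2 * p) X') (hX : IsSmoothProjective (2 * p) X)
    (hσ : Literature.AlgebraicGeometry.Resolution.IsBirational σ.left) (ℓ s : ℕ) :
    LevelClean ℓ s p X' ↔ LevelClean ℓ s p X :=
  ⟨levelClean_of_isBirational σ hp hX' hX hσ ℓ s,
    fun hC z' hz' ↦ stub_heartOfBirationalUp σ hp hX' hX hσ ℓ s hC z' hz'⟩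

/-- **The N¹-top sector is a birational invariant in the middle degree** (descent p161788 + ascent
`stub_supportedTopOfBirationalUp`): for `σ : X' ⟶ X` birational between smooth projective `2p`-folds,
`supportedClasses X' (2p) 1 = ⊤ ↔ supportedClasses X (2p) 1 = ⊤` — so the open locus of the heart
(`supportedClasses X (2p) 1 ≠ ⊤`, p162249) is birationally stable. -/
theorem supportedClasses_eq_top_iff_of_isBirational {p : ℕ} {X' X : SchemeOver ℂ} (σ : X' ⟶ X)
    (hp : 1 ≤ p) (hX' : IsSmoothProjective (2 * p) X') (hX : IsSmoothProjective (2 * p) X)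
    (hσ : Literature.AlgebraicGeometry.Resolution.IsBirational σ.left) :
    supportedClasses X' (2 * p) 1 = ⊤ ↔ supportedClasses X (2 * p) 1 = ⊤ :=
  haveI : IsProper σ.left := isProper_left_of_isSmoothProjective hX' hX σ
  ⟨fun h ↦ Summit.HodgeConjecture.HodgeConjecture.Theorems.genericDivisibilityBounded_supportedClasses_eq_top_of_surjective
      hX' hX σ (surjective_base_of_isBirational σ.left hσ) h,
    fun h ↦ stub_supportedTopOfBirationalUp σ hX' hX hσ (2 * p) (2 * p) (by omega) (by omega) h⟩

/-- **The heart at `ℓ` ⟺ bounded `ℓ`-exponent at the generic point** (`stub_levelCleanIffBoundedGenericTorsion`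
in the line's vocabulary): `LevelClean ℓ (a+1) p X` iff `ℓ^a` kills, up to torsion, every generic class an
`ℓ`-power multiple of which comes from `X` up to torsion. -/
theorem levelClean_succ_iff_boundedGenericTorsion {p : ℕ} {X : SchemeOver ℂ} [IrreducibleSpace X.left]
    {ℓ : ℕ} (hℓ : 1 ≤ ℓ) (a : ℕ) :
    LevelClean ℓ (a + 1) p X ↔
      ∀ (f : functionFieldCohomology ℤ X (2 * p)) (r : ℕ),
        (∃ (z : Hint X (2 * p)) (M : ℕ), 1 ≤ M ∧ M • (toFunctionField ℤ X (2 * p) z - ℓ ^ r • f) = 0) →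
        ∃ (w : Hint X (2 * p)) (N : ℕ), 1 ≤ N ∧ N • (toFunctionField ℤ X (2 * p) w - ℓ ^ a • f) = 0 :=
  stub_levelCleanIffBoundedGenericTorsion (2 * p) ℓ a hℓ


/-- **Surface sanity check of the bounded-exponent form (exponent `ℓ^0`).** On a smooth projective
surface every level `ℓ^1` is clean (`surfaceLevelOne_holds`, p145990 + p146835), so by
`levelClean_succ_iff_boundedGenericTorsion` with `a = 0`: a generic degree-2 class an `ℓ`-power multiple
of which comes from `X` up to torsion itself comes from `X` up to torsion — the image of `H²(X(ℂ);ℤ)`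
in `H²(ℂ(X);ℤ)/tors` is `ℓ`-saturated for every prime `ℓ` (CT–Voisin 2012 §4.1: `H²_nr(X;ℤ)/E = 0`). -/
theorem surface_generic_image_saturated {X : SchemeOver ℂ} [IrreducibleSpace X.left]
    (hX : IsSmoothProjective (2 * 1) X) {ℓ : ℕ} (hℓ : ℓ.Prime)
    (f : functionFieldCohomology ℤ X (2 * 1)) (r : ℕ)
    (hf : ∃ (z : Hint X (2 * 1)) (M : ℕ), 1 ≤ M ∧ M • (toFunctionField ℤ X (2 * 1) z - ℓ ^ r • f) = 0) :
    ∃ (w : Hint X (2 * 1)) (N : ℕ), 1 ≤ N ∧ N • (toFunctionField ℤ X (2 * 1) w - ℓ ^ 0 • f) = 0 :=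
  (levelClean_succ_iff_boundedGenericTorsion (p := 1) hℓ.one_lt.le 0).1
    ((sig_stub_surfaceLevelOne_iff.1 surfaceLevelOne_holds) hX ℓ hℓ) f r hf

/-- The one-line re-export of p163474 (`stub_levelCleanIffFunctionField`): the heart at `(ℓ, s, X)` entirely
at the generic point. -/
theorem levelClean_iff_functionField {p : ℕ} {X : SchemeOver ℂ} [IrreducibleSpace X.left] (ℓ s : ℕ) :
    LevelClean ℓ s p X ↔ ∀ z : Hint X (2 * p),
      (∃ (f : functionFieldCohomology ℤ X (2 * p)) (M : ℕ), 1 ≤ M ∧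
        M • (toFunctionField ℤ X (2 * p) z - ℓ ^ s • f) = 0) →
      ∃ (w : Hint X (2 * p)) (N : ℕ), 1 ≤ N ∧ toFunctionField ℤ X (2 * p) (N • (z - ℓ • w)) = 0 :=
  Summit.HodgeConjecture.HodgeConjecture.Theorems.stub_levelCleanIffFunctionField (2 * p) ℓ s


/-! ### Sub-goals of lead c5, wave 2: the HODGE-RESTRICTED heart is HC-strength, not more

`A(X) := {z ∈ H²ᵖ(X(ℂ);ℤ) : z ⊗ ℂ ≡ h mod N¹ for some RATIONAL class h of Hodge type (p,p)}` ("Hodge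
modulo coniveau one"; it contains `GT` and all integral Hodge classes, and is saturated). Registered stubs:
* `stub_levelCleanOnHodgeOfHodgeConjectureFor` — `HodgeConjectureFor (2p) X` ⟹ the heart RESTRICTED TO
  `A(X)` holds at EVERY `(ℓ, s)` (with `w = 0`: `h` is algebraic, `Nᵖ ⊆ N¹`, so `z ⊗ ℂ ∈ N¹`, `z ∈ GT`);
* `stub_hodgeModConiveau_of_sub_genericallyTorsion` — `A(X)` is stable under the bootstrap step:
  `z ∈ A`, `z - c • w ∈ GT` (`c ≥ 1`) ⟹ `w ∈ A` (`GT ⊗ ℂ ⊆ N¹`, divide `h` by `c`);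
* `stub_cruxAtOfLevelCleanOn` — the funnel `one clean level ⟹ C2 at X` RELATIVE to any predicate `P`
  stable under the bootstrap step (`P z`, `z - ℓ^(j+1) • w ∈ GT` ⟹ `P w`): clean level on `P` ⟹ C2 on `P`.
Assembly (below; all three stubs LANDED in wave 2 — p168623, p168784, p168748): the Hodge-restricted heart `HeartHdg` (one clean prime on `A(X)` for
every `X`) gives C2_Hdg, hence with C1 the Hodge conjecture (p156175), and conversely HC ⟹ HeartHdg; so
granted `TorsionDiesGenerically`, `HC ⟺ C1 ∧ HeartHdg`: restricted to Hodge-mod-coniveau classes the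
line's heart is EXACTLY HC-hard, and its whole surplus over HC is the non-Hodge phantom question Q1
(HEART-c2 §F). -/

/-- **Sub-goal `stub_levelCleanOnHodgeOfHodgeConjectureFor` (lead c5, wave 2), LANDED p168623
(`Theorems/…HeartHodgeOfHC`): HC at `X` ⟹ the Hodge-restricted heart at `X` at every `(ℓ, s)`.** -/
theorem stub_levelCleanOnHodgeOfHodgeConjectureFor :
    ∀ ⦃p : ℕ⦄ ⦃X : SchemeOver ℂ⦄, 1 ≤ p → IsSmoothProjective (2 * p) X → HodgeConjectureFor (2 * p) X →
      ∀ (ℓ s : ℕ) (z : singularCohomology ℤ ℤ (ComplexPoints X) (2 * p)),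
        (∃ h : complexBetti X (2 * p), IsRationalClass h ∧ IsOfHodgeType (2 * p) X (2 * p) p p h ∧
          singularCohomology.ringChange (Int.castRingHom ℂ) (ComplexPoints X) (2 * p) z - h ∈
            supportedClasses X (2 * p) 1) →
        (∃ Z : Set X.left, IsClosed Z ∧ Z ≠ Set.univ ∧
          ∃ (y : singularCohomology ℤ ℤ (complexPointsCompl X Z) (2 * p)) (M : ℕ), 1 ≤ M ∧
            M • (singularCohomology.map ℤ ℤ
              (⟨Subtype.val, continuous_subtype_val⟩ : C(complexPointsCompl X Z, ComplexPoints X))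
              (2 * p) z - ℓ ^ s • y) = 0) →
        ∃ w : singularCohomology ℤ ℤ (ComplexPoints X) (2 * p),
          ∃ Z : Set X.left, IsClosed Z ∧ Z ≠ Set.univ ∧ ∃ N : ℕ, 1 ≤ N ∧
            N • singularCohomology.map ℤ ℤ
              (⟨Subtype.val, continuous_subtype_val⟩ : C(complexPointsCompl X Z, ComplexPoints X))
              (2 * p) (z - ℓ • w) = 0 :=
  Summit.HodgeConjecture.HodgeConjecture.Theorems.stub_levelCleanOnHodgeOfHodgeConjectureFor

/-- **Sub-goal `stub_hodgeModConiveau_of_sub_genericallyTorsion` (lead c5, wave 2), LANDED p168784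
(`Theorems/…HodgeModConiveauStable`): "Hodge modulo coniveau one" is stable under the bootstrap step.** -/
theorem stub_hodgeModConiveau_of_sub_genericallyTorsion :
    ∀ ⦃p : ℕ⦄ ⦃X : SchemeOver ℂ⦄, 1 ≤ p → IsSmoothProjective (2 * p) X →
      ∀ (z w : singularCohomology ℤ ℤ (ComplexPoints X) (2 * p)) (c : ℕ), 1 ≤ c →
        (∃ h : complexBetti X (2 * p), IsRationalClass h ∧ IsOfHodgeType (2 * p) X (2 * p) p p h ∧
          singularCohomology.ringChange (Int.castRingHom ℂ) (ComplexPoints X) (2 * p) z - h ∈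
            supportedClasses X (2 * p) 1) →
        (∃ Z : Set X.left, IsClosed Z ∧ Z ≠ Set.univ ∧ ∃ N : ℕ, 1 ≤ N ∧
          N • singularCohomology.map ℤ ℤ
            (⟨Subtype.val, continuous_subtype_val⟩ : C(complexPointsCompl X Z, ComplexPoints X))
            (2 * p) (z - c • w) = 0) →
        ∃ h : complexBetti X (2 * p), IsRationalClass h ∧ IsOfHodgeType (2 * p) X (2 * p) p p h ∧
          singularCohomology.ringChange (Int.castRingHom ℂ) (ComplexPoints X) (2 * p) w - h ∈
            supportedClasses X (2 * p) 1 :=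
  Summit.HodgeConjecture.HodgeConjecture.Theorems.stub_hodgeModConiveau_of_sub_genericallyTorsion

/-- **Sub-goal `stub_cruxAtOfLevelCleanOn` (lead c5, wave 2), LANDED p168748 (`Theorems/…FunnelOn`): the
funnel relative to a bootstrap-stable predicate.** -/
theorem stub_cruxAtOfLevelCleanOn :
    ∀ ⦃n₀ : ℕ⦄ ⦃X : SchemeOver ℂ⦄, IsSmoothProjective n₀ X → ∀ (k ℓ s : ℕ), ℓ.Prime → 1 ≤ s →
      ∀ (P : singularCohomology ℤ ℤ (ComplexPoints X) k → Prop),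
        (∀ (z w : singularCohomology ℤ ℤ (ComplexPoints X) k) (j : ℕ), P z →
          (∃ Z : Set X.left, IsClosed Z ∧ Z ≠ Set.univ ∧ ∃ N : ℕ, 1 ≤ N ∧
            N • singularCohomology.map ℤ ℤ
              (⟨Subtype.val, continuous_subtype_val⟩ : C(complexPointsCompl X Z, ComplexPoints X))
              k (z - ℓ ^ (j + 1) • w) = 0) → P w) →
        (∀ z : singularCohomology ℤ ℤ (ComplexPoints X) k, P z →
          (∃ Z : Set X.left, IsClosed Z ∧ Z ≠ Set.univ ∧
            ∃ (y : singularCohomology ℤ ℤ (complexPointsCompl X Z) k) (M : ℕ), 1 ≤ M ∧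
              M • (singularCohomology.map ℤ ℤ
                (⟨Subtype.val, continuous_subtype_val⟩ : C(complexPointsCompl X Z, ComplexPoints X))
                k z - ℓ ^ s • y) = 0) →
          ∃ w : singularCohomology ℤ ℤ (ComplexPoints X) k,
            ∃ Z : Set X.left, IsClosed Z ∧ Z ≠ Set.univ ∧ ∃ N : ℕ, 1 ≤ N ∧
              N • singularCohomology.map ℤ ℤ
                (⟨Subtype.val, continuous_subtype_val⟩ : C(complexPointsCompl X Z, ComplexPoints X))
                k (z - ℓ • w) = 0) →
        ∀ z : singularCohomology ℤ ℤ (ComplexPoints X) k, P z →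
          (∀ m : ℕ, 1 ≤ m → ∃ Z : Set X.left, IsClosed Z ∧ Z ≠ Set.univ ∧
            ∃ y : singularCohomology ℤ ℤ (complexPointsCompl X Z) k,
              m • y = singularCohomology.map ℤ ℤ
                (⟨Subtype.val, continuous_subtype_val⟩ : C(complexPointsCompl X Z, ComplexPoints X)) k z) →
          singularCohomology.ringChange (Int.castRingHom ℂ) (ComplexPoints X) k z ∈ supportedClasses X k 1 :=
  Summit.HodgeConjecture.HodgeConjecture.Theorems.stub_cruxAtOfLevelCleanOn

/-- **Sub-goal `stub_hodgeConjectureIffC1AndHeartHdg` (lead c5, wave-2 assembly), LANDED p169015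
(`Theorems/…HeartHodgeIffHC`, def-free): modulo `TorsionDiesGenerically`, `HC ⟺ C1 ∧ HeartHdg`.** -/
theorem stub_hodgeConjectureIffC1AndHeartHdg :
    TorsionDiesGenerically → (_root_.HodgeConjecture ↔
      (HodgeClassesGenericallyDivisible ∧
        ∀ ⦃p : ℕ⦄ ⦃X : SchemeOver ℂ⦄, 2 ≤ p → IsSmoothProjective (2 * p) X →
          ∃ ℓ s : ℕ, ℓ.Prime ∧ 1 ≤ s ∧ ∀ z : singularCohomology ℤ ℤ (ComplexPoints X) (2 * p),
            (∃ h : complexBetti X (2 * p), IsRationalClass h ∧ IsOfHodgeType (2 * p) X (2 * p) p p h ∧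
              singularCohomology.ringChange (Int.castRingHom ℂ) (ComplexPoints X) (2 * p) z - h ∈
                supportedClasses X (2 * p) 1) →
            (∃ Z : Set X.left, IsClosed Z ∧ Z ≠ Set.univ ∧
              ∃ (y : singularCohomology ℤ ℤ (complexPointsCompl X Z) (2 * p)) (M : ℕ), 1 ≤ M ∧
                M • (singularCohomology.map ℤ ℤ
                  (⟨Subtype.val, continuous_subtype_val⟩ : C(complexPointsCompl X Z, ComplexPoints X))
                  (2 * p) z - ℓ ^ s • y) = 0) →
            ∃ w : singularCohomology ℤ ℤ (ComplexPoints X) (2 * p),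
              ∃ Z : Set X.left, IsClosed Z ∧ Z ≠ Set.univ ∧ ∃ N : ℕ, 1 ≤ N ∧
                N • singularCohomology.map ℤ ℤ
                  (⟨Subtype.val, continuous_subtype_val⟩ : C(complexPointsCompl X Z, ComplexPoints X))
                  (2 * p) (z - ℓ • w) = 0)) :=
  Summit.HodgeConjecture.HodgeConjecture.Theorems.stub_hodgeConjectureIffC1AndHeartHdg

/-! ### Assembly of wave 2: `HC ⟺ C1 ∧ HeartHdg` modulo `TorsionDiesGenerically` -/

/-- `z ∈ A(X)`: the integral class `z ∈ H²ᵖ(X(ℂ);ℤ)` is **Hodge modulo coniveau one** — its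
complexification differs from a RATIONAL class of Hodge type `(p,p)` by a class of `N¹`. -/
def HodgeModConiveauOne (X : SchemeOver ℂ) (p : ℕ) (z : Hint X (2 * p)) : Prop :=
  ∃ h : complexBetti X (2 * p), IsRationalClass h ∧ IsOfHodgeType (2 * p) X (2 * p) p p h ∧
    singularCohomology.ringChange (Int.castRingHom ℂ) (ComplexPoints X) (2 * p) z - h ∈
      supportedClasses X (2 * p) 1

/-- **`HeartHdg`, the Hodge-restricted heart**: on every smooth projective `2p`-fold (`p ≥ 2`) some prime
has a finite level clean ON `A(X)` (classes Hodge modulo coniveau one). -/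
def Sig.heartHdg : Prop :=
  ∀ ⦃p : ℕ⦄ ⦃X : SchemeOver ℂ⦄, 2 ≤ p → IsSmoothProjective (2 * p) X →
    ∃ ℓ s : ℕ, ℓ.Prime ∧ 1 ≤ s ∧ ∀ z : Hint X (2 * p), HodgeModConiveauOne X p z →
      DivisibleUpToTorsionOnOpen X (2 * p) (ℓ ^ s) z → ∃ w : Hint X (2 * p), GenericallyTorsion X (2 * p) (z - ℓ • w)

/-- `C2_Hdg`, the Hodge-restricted crux (C2 for integral classes of Hodge type `(p,p)`), spelled as in
`Theorems.genericDivisibility_hodgeConjecture_of_hodgeBounded` (p156175). -/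
def Sig.cruxHdg : Prop :=
  ∀ ⦃p : ℕ⦄ ⦃X : SchemeOver ℂ⦄, 1 ≤ p → IsSmoothProjective (2 * p) X →
    ∀ z : singularCohomology ℤ ℤ (ComplexPoints X) (2 * p),
      IsOfHodgeType (2 * p) X (2 * p) p p
        (singularCohomology.ringChange (Int.castRingHom ℂ) (ComplexPoints X) (2 * p) z) →
      (∀ m : ℕ, 1 ≤ m → ∃ Z : Set X.left, IsClosed Z ∧ Z ≠ Set.univ ∧
        ∃ y : singularCohomology ℤ ℤ (complexPointsCompl X Z) (2 * p), m • y = res X Z (2 * p) z) →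
      singularCohomology.ringChange (Int.castRingHom ℂ) (ComplexPoints X) (2 * p) z ∈
        supportedClasses X (2 * p) 1

/-- The Hodge-free heart implies the Hodge-restricted one (drop the restriction). -/
theorem heartHdg_of_heart (h : Sig.stub_finiteLevel) : Sig.heartHdg := by
  intro p X hp hX
  obtain ⟨ℓ, s, hℓ, hs, hclean⟩ := (sig_stub_finiteLevel_iff.1 h) hp hX
  exact ⟨ℓ, s, hℓ, hs, fun z _ hz ↦ hclean z hz⟩

/-- An integral class of Hodge type `(p,p)` is Hodge modulo coniveau one (`h = z ⊗ ℂ`). -/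
theorem hodgeModConiveauOne_of_isOfHodgeType {p : ℕ} {X : SchemeOver ℂ} {z : Hint X (2 * p)}
    (hz : IsOfHodgeType (2 * p) X (2 * p) p p
      (singularCohomology.ringChange (Int.castRingHom ℂ) (ComplexPoints X) (2 * p) z)) :
    HodgeModConiveauOne X p z :=
  ⟨_, ((isIntegralClass_iff_mem_range_ringChange _).2 ⟨z, rfl⟩).isRationalClass, hz,
    by rw [sub_self]; exact Submodule.zero_mem _⟩

/-- **`HeartHdg ⟹ C2_Hdg`**: the Hodge-restricted heart closes the Hodge-restricted crux — the funnel
relative to `A(X)` (`stub_cruxAtOfLevelCleanOn`, p168748), which is bootstrap-stable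
(`stub_hodgeModConiveau_of_sub_genericallyTorsion`, p168784) and contains the Hodge classes; `p = 1` is
the landed crux `genericDivisibilityBounded_one`. -/
theorem cruxHdg_of_heartHdg (h : Sig.heartHdg) : Sig.cruxHdg := by
  intro p X hp hX z hz hdiv
  rcases Nat.lt_or_ge p 2 with hp1 | hp2
  · obtain rfl : p = 1 := by omega
    exact genericDivisibilityBounded_one hX z hdiv
  obtain ⟨ℓ, s, hℓ, hs, hclean⟩ := h hp2 hX
  refine stub_cruxAtOfLevelCleanOn hX (2 * p) ℓ s hℓ hs (HodgeModConiveauOne X p)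
    (fun z w j hPz hGT ↦ stub_hodgeModConiveau_of_sub_genericallyTorsion hp hX z w (ℓ ^ (j + 1))
      (Nat.one_le_pow _ _ hℓ.pos) hPz hGT)
    (fun z hPz hz ↦ hclean z hPz hz) z (hodgeModConiveauOne_of_isOfHodgeType hz) hdiv

/-- **`HC ⟹ HeartHdg`** (every `(ℓ, s)`, here `ℓ = 2`, `s = 1`; `stub_levelCleanOnHodgeOfHodgeConjectureFor`,
p168623): under the Hodge conjecture every class of `A(X)` is generically torsion. -/
theorem heartHdg_of_hodgeConjecture (hHC : _root_.HodgeConjecture) : Sig.heartHdg :=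
  fun p X hp hX ↦ ⟨2, 1, Nat.prime_two, le_rfl, fun z hz hD ↦
    stub_levelCleanOnHodgeOfHodgeConjectureFor (by omega) hX (hHC hX) 2 1 z hz hD⟩

/-- **`C1 ∧ HeartHdg ⟹ HC`** (with p156175 `genericDivisibility_hodgeConjecture_of_hodgeBounded`). -/
theorem hodgeConjecture_of_C1_of_heartHdg (h1 : HodgeClassesGenericallyDivisible) (h : Sig.heartHdg) :
    _root_.HodgeConjecture :=
  Summit.HodgeConjecture.HodgeConjecture.Theorems.genericDivisibility_hodgeConjecture_of_hodgeBounded h1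
    (cruxHdg_of_heartHdg h)

/-- **Modulo `TorsionDiesGenerically`, `HC ⟺ C1 ∧ HeartHdg`**: restricted to classes Hodge modulo
coniveau one, the line's heart is EXACTLY as hard as the Hodge conjecture (given the route's other crux
C1); its entire surplus over HC is the non-Hodge phantom question (HEART-c2 §F, Q1). The forward
direction to C1 is seat 0's `genericDivisibility_hodgeConjecture_iff_of_torsionDiesGenerically`. -/
theorem hodgeConjecture_iff_C1_and_heartHdg (hT : TorsionDiesGenerically) :
    _root_.HodgeConjecture ↔ (HodgeClassesGenericallyDivisible ∧ Sig.heartHdg) :=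
  ⟨fun hHC ↦ ⟨((Summit.HodgeConjecture.HodgeConjecture.Theorems.genericDivisibility_hodgeConjecture_iff_of_torsionDiesGenerically
      hT).1 hHC).1, heartHdg_of_hodgeConjecture hHC⟩,
    fun h ↦ hodgeConjecture_of_C1_of_heartHdg h.1 h.2⟩


/-! ### Sub-goal of lead c5, wave 3: the SNC normal form of the heart (idea `birational-snc-descent`)

Granted log resolution of proper closed subsets of smooth projective complex varieties (Kollár 2007
Thm. 3.26 "Principalization III" with `E = ∅` applied to the ideal of `Z`: a composite of smooth blow-ups
`σ : X' → X` with `σ⁻¹(Z)` a simple-normal-crossing divisor; Hironaka 1964 Main Theorem II), spelled as an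
explicit hypothesis over the tree's `Resolution.IsBirational` / `Resolution.HasSNC`, level `ℓ^s` is clean at
`X` as soon as it is clean FOR SNC WITNESSES on every smooth projective birational model `X' → X`: pull
`D'(ℓ^s, z)` back to `X'` (its witness becomes `σ⁻¹(Z) = ⋃ supp E`, SNC), apply the SNC-clean hypothesis,
push forward by the integral Gysin map of degree one (`σ_! σ^* = id`, `σ_!(GT) ⊆ GT`, p162684). So the heart
may be attacked on complements of SNC divisors only, where `H^{2p}((X'∖D)(ℂ);ℤ)` is computed from the smooth
strata (Deligne; the tree's `GysinKernelSNC` road). -/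

/-- **Sub-goal `stub_levelCleanOfSNCWitnesses` (lead c5, wave 3), LANDED p169430 (`Theorems/…SNCWitnesses`): the
heart at `(ℓ, s)` follows from its SNC-witness form on all smooth projective birational models, granted log
resolution (explicit hypothesis; Kollár 2007 Thm. 3.26).** -/
theorem stub_levelCleanOfSNCWitnesses :
    (∀ (n : ℕ) (X : SchemeOver ℂ), IsSmoothProjective n X → ∀ Z : Set X.left, IsClosed Z → Z ≠ Set.univ →
      ∃ (X' : SchemeOver ℂ) (σ : X' ⟶ X) (E : List X'.left.IdealSheafData),
        IsSmoothProjective n X' ∧ Literature.AlgebraicGeometry.Resolution.IsBirational σ.left ∧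
        Literature.AlgebraicGeometry.Resolution.HasSNC E ∧
        σ.left.base ⁻¹' Z = ⋃ D ∈ E, ((D.support : Set X'.left))) →
    ∀ ⦃p : ℕ⦄ ⦃X : SchemeOver ℂ⦄, 1 ≤ p → IsSmoothProjective (2 * p) X → ∀ ℓ s : ℕ,
      (∀ (X' : SchemeOver ℂ) (σ : X' ⟶ X) (E : List X'.left.IdealSheafData),
        IsSmoothProjective (2 * p) X' → Literature.AlgebraicGeometry.Resolution.IsBirational σ.left →
        Literature.AlgebraicGeometry.Resolution.HasSNC E →
        (⋃ D ∈ E, ((D.support : Set X'.left))) ≠ Set.univ →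
        ∀ z' : singularCohomology ℤ ℤ (ComplexPoints X') (2 * p),
          (∃ (y : singularCohomology ℤ ℤ (complexPointsCompl X' (⋃ D ∈ E, ((D.support : Set X'.left)))) (2 * p))
              (M : ℕ), 1 ≤ M ∧
            M • (singularCohomology.map ℤ ℤ
              (⟨Subtype.val, continuous_subtype_val⟩ :
                C(complexPointsCompl X' (⋃ D ∈ E, ((D.support : Set X'.left))), ComplexPoints X'))
              (2 * p) z' - ℓ ^ s • y) = 0) →
          ∃ w : singularCohomology ℤ ℤ (ComplexPoints X') (2 * p),
            ∃ Z' : Set X'.left, IsClosed Z' ∧ Z' ≠ Set.univ ∧ ∃ N : ℕ, 1 ≤ N ∧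
              N • singularCohomology.map ℤ ℤ
                (⟨Subtype.val, continuous_subtype_val⟩ : C(complexPointsCompl X' Z', ComplexPoints X'))
                (2 * p) (z' - ℓ • w) = 0) →
      ∀ z : singularCohomology ℤ ℤ (ComplexPoints X) (2 * p),
        (∃ Z : Set X.left, IsClosed Z ∧ Z ≠ Set.univ ∧
          ∃ (y : singularCohomology ℤ ℤ (complexPointsCompl X Z) (2 * p)) (M : ℕ), 1 ≤ M ∧
            M • (singularCohomology.map ℤ ℤ
              (⟨Subtype.val, continuous_subtype_val⟩ : C(complexPointsCompl X Z, ComplexPoints X))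
              (2 * p) z - ℓ ^ s • y) = 0) →
        ∃ w : singularCohomology ℤ ℤ (ComplexPoints X) (2 * p),
          ∃ Z : Set X.left, IsClosed Z ∧ Z ≠ Set.univ ∧ ∃ N : ℕ, 1 ≤ N ∧
            N • singularCohomology.map ℤ ℤ
              (⟨Subtype.val, continuous_subtype_val⟩ : C(complexPointsCompl X Z, ComplexPoints X))
              (2 * p) (z - ℓ • w) = 0 :=
  Summit.HodgeConjecture.HodgeConjecture.Theorems.stub_levelCleanOfSNCWitnesses

/-! ### Sub-goals of lead c6 (cycle 8): the heart DESCENDS along surjections of ANY nonzero degree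
(level shift `v_ℓ(deg)`), and the SNC normal form of the heart made UNCONDITIONAL

Registered sub-goal stubs of this cycle, wave 1 — BOTH LANDED (p172282, p172376; signatures def-free, no `:=` token):
* `stub_heartOfHasDegree` — for `f : X' ⟶ X` onto between smooth projective `2p`-folds, of degree
  `ℓ^v d'` (`gcd(ℓ, d') = 1`, `ℓ ≥ 1`) for integral orientations `μ`, `ν`: level `ℓ^s` clean at `X'` ⟹
  level `ℓ^(v+s)` clean at `X`. Proof route: `D'(ℓ^(v+s), z) ⇒ D'(ℓ^(v+s), f^*z)`
  (`genericDivisibilityBounded_levelDivisible_map`); the landed BOOTSTRAP at `X'`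
  (`genericDivisibilityBounded_bootstrap`, `n = v`) gives `f^*z - ℓ^(v+1) • w' ∈ GT(X')`; push forward by the
  integral Gysin map (`genericDivisibilityBounded_gysinMap_genericallyTorsion`, `gysinMap_map_of_hasDegree`):
  `ℓ^v • (d' • z - ℓ • f_! w') = (ℓ^v d') • z - ℓ^(v+1) • f_! w' ∈ GT(X)`; `GT` is SATURATED
  (`genericDivisibilityBounded_genericallyTorsion_of_nsmul`), so `d' • z - ℓ • f_! w' ∈ GT(X)`; Bézout
  (`genericDivisibilityBounded_bezout_smul`). This removes the coprimality hypothesis of p162684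
  (`stub_heartOfHasDegreeCoprime`, the case `v = 0`): since the heart is `∃ s`, **the heart at `ℓ` descends
  along EVERY surjection of nonzero degree** (finite quotients `A → A/G` resolved, for ALL `G`; spans).
* `stub_levelCleanOfSNCWitnessesUnconditional` — the second half of `stub_levelCleanOfSNCWitnesses` (p169430)
  with its log-resolution hypothesis DISCHARGED by the tree's proved
  `Literature.AlgebraicGeometry.Resolution.exists_logResolution_isSmoothProjective_hasSNC` (Kollár 2007
  Thm. 3.21 via the proved marked-ideal order reduction): **the heart at `(ℓ, s)` follows from its SNC-witness
  form on the smooth projective birational models of `X`, unconditionally.** -/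

/-- **Sub-goal `stub_heartOfHasDegree` (lead c6), LANDED p172282 (`Theorems/…HeartOfHasDegree`, wave-1
worker; general form `genericDivisibilityBounded_levelClean_of_hasDegree_pow` for any `n`, `k + q = 2n`):
the heart descends along surjective morphisms of ANY nonzero degree, with level shift the `ℓ`-adic
valuation of the degree.** -/
theorem stub_heartOfHasDegree :
    ∀ ⦃p : ℕ⦄ ⦃X' X : SchemeOver ℂ⦄ (f : X' ⟶ X)
      (μ : HomologicalOrientation ℤ (ComplexPoints X') (2 * (2 * p)))
      (ν : HomologicalOrientation ℤ (ComplexPoints X) (2 * (2 * p))) (ℓ v : ℕ) (d' : ℤ),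
      1 ≤ p → IsSmoothProjective (2 * p) X' → IsSmoothProjective (2 * p) X →
      HasDegree μ ν (AlgPoints.mapContinuous f) ((ℓ : ℤ) ^ v * d') → Function.Surjective f.left.base →
      1 ≤ ℓ → IsCoprime (ℓ : ℤ) d' → ∀ s : ℕ,
      (∀ z' : singularCohomology ℤ ℤ (ComplexPoints X') (2 * p),
        (∃ Z : Set X'.left, IsClosed Z ∧ Z ≠ Set.univ ∧
          ∃ (y : singularCohomology ℤ ℤ (complexPointsCompl X' Z) (2 * p)) (M : ℕ), 1 ≤ M ∧
            M • (singularCohomology.map ℤ ℤ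
              (⟨Subtype.val, continuous_subtype_val⟩ : C(complexPointsCompl X' Z, ComplexPoints X'))
              (2 * p) z' - ℓ ^ s • y) = 0) →
        ∃ w : singularCohomology ℤ ℤ (ComplexPoints X') (2 * p),
          ∃ Z : Set X'.left, IsClosed Z ∧ Z ≠ Set.univ ∧ ∃ N : ℕ, 1 ≤ N ∧
            N • singularCohomology.map ℤ ℤ
              (⟨Subtype.val, continuous_subtype_val⟩ : C(complexPointsCompl X' Z, ComplexPoints X'))
              (2 * p) (z' - ℓ • w) = 0) →
      ∀ z : singularCohomology ℤ ℤ (ComplexPoints X) (2 * p),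
        (∃ Z : Set X.left, IsClosed Z ∧ Z ≠ Set.univ ∧
          ∃ (y : singularCohomology ℤ ℤ (complexPointsCompl X Z) (2 * p)) (M : ℕ), 1 ≤ M ∧
            M • (singularCohomology.map ℤ ℤ
              (⟨Subtype.val, continuous_subtype_val⟩ : C(complexPointsCompl X Z, ComplexPoints X))
              (2 * p) z - ℓ ^ (v + s) • y) = 0) →
        ∃ w : singularCohomology ℤ ℤ (ComplexPoints X) (2 * p),
          ∃ Z : Set X.left, IsClosed Z ∧ Z ≠ Set.univ ∧ ∃ N : ℕ, 1 ≤ N ∧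
            N • singularCohomology.map ℤ ℤ
              (⟨Subtype.val, continuous_subtype_val⟩ : C(complexPointsCompl X Z, ComplexPoints X))
              (2 * p) (z - ℓ • w) = 0 :=
  Summit.HodgeConjecture.HodgeConjecture.Theorems.stub_heartOfHasDegree

/-- **Sub-goal `stub_levelCleanOfSNCWitnessesUnconditional` (lead c6), LANDED p172376
(`Theorems/…SNCWitnessesUnconditional`, wave-1 worker; the tree already carried the log-resolution
repackaging `Resolution.exists_isBirational_hasSNC_preimage_eq`): the SNC normal form of the heart,
unconditionally** — level `ℓ^s` is clean at the smooth projective `2p`-fold `X` (`p ≥ 1`) as soon as it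
is clean FOR SNC WITNESS SETS `⋃ supp E ≠ X'` on every smooth projective birational model `σ : X' ⟶ X`
(log resolution of the witness: `Resolution.exists_logResolution_isSmoothProjective_hasSNC`, proved in the
tree; then p169430). -/
theorem stub_levelCleanOfSNCWitnessesUnconditional :
    ∀ ⦃p : ℕ⦄ ⦃X : SchemeOver ℂ⦄, 1 ≤ p → IsSmoothProjective (2 * p) X → ∀ ℓ s : ℕ,
      (∀ (X' : SchemeOver ℂ) (σ : X' ⟶ X) (E : List X'.left.IdealSheafData),
        IsSmoothProjective (2 * p) X' → Literature.AlgebraicGeometry.Resolution.IsBirational σ.left →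
        Literature.AlgebraicGeometry.Resolution.HasSNC E →
        (⋃ D ∈ E, ((D.support : Set X'.left))) ≠ Set.univ →
        ∀ z' : singularCohomology ℤ ℤ (ComplexPoints X') (2 * p),
          (∃ (y : singularCohomology ℤ ℤ (complexPointsCompl X' (⋃ D ∈ E, ((D.support : Set X'.left)))) (2 * p))
              (M : ℕ), 1 ≤ M ∧
            M • (singularCohomology.map ℤ ℤ
              (⟨Subtype.val, continuous_subtype_val⟩ :
                C(complexPointsCompl X' (⋃ D ∈ E, ((D.support : Set X'.left))), ComplexPoints X'))
              (2 * p) z' - ℓ ^ s • y) = 0) →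
          ∃ w : singularCohomology ℤ ℤ (ComplexPoints X') (2 * p),
            ∃ Z' : Set X'.left, IsClosed Z' ∧ Z' ≠ Set.univ ∧ ∃ N : ℕ, 1 ≤ N ∧
              N • singularCohomology.map ℤ ℤ
                (⟨Subtype.val, continuous_subtype_val⟩ : C(complexPointsCompl X' Z', ComplexPoints X'))
                (2 * p) (z' - ℓ • w) = 0) →
      ∀ z : singularCohomology ℤ ℤ (ComplexPoints X) (2 * p),
        (∃ Z : Set X.left, IsClosed Z ∧ Z ≠ Set.univ ∧
          ∃ (y : singularCohomology ℤ ℤ (complexPointsCompl X Z) (2 * p)) (M : ℕ), 1 ≤ M ∧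
            M • (singularCohomology.map ℤ ℤ
              (⟨Subtype.val, continuous_subtype_val⟩ : C(complexPointsCompl X Z, ComplexPoints X))
              (2 * p) z - ℓ ^ s • y) = 0) →
        ∃ w : singularCohomology ℤ ℤ (ComplexPoints X) (2 * p),
          ∃ Z : Set X.left, IsClosed Z ∧ Z ≠ Set.univ ∧ ∃ N : ℕ, 1 ≤ N ∧
            N • singularCohomology.map ℤ ℤ
              (⟨Subtype.val, continuous_subtype_val⟩ : C(complexPointsCompl X Z, ComplexPoints X))
              (2 * p) (z - ℓ • w) = 0 :=
  Summit.HodgeConjecture.HodgeConjecture.Theorems.stub_levelCleanOfSNCWitnessesUnconditional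

/-! ### Assembly of lead c6, wave 1: the heart at `ℓ` descends along every surjection with a
nonzero degree datum, along spans, and is checked on SNC witnesses only -/

/-- `LevelClean` form of `stub_heartOfHasDegree`: for `f : X' ⟶ X` onto between smooth projective
`2p`-folds of degree `ℓ^v d'` (`gcd(ℓ, d') = 1`, `ℓ ≥ 1`), `LevelClean ℓ s p X' → LevelClean ℓ (v + s) p X`. -/
theorem levelClean_of_hasDegree_pow {p : ℕ} {X' X : SchemeOver ℂ} (f : X' ⟶ X)
    (μ : HomologicalOrientation ℤ (ComplexPoints X') (2 * (2 * p)))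
    (ν : HomologicalOrientation ℤ (ComplexPoints X) (2 * (2 * p))) {ℓ v : ℕ} {d' : ℤ} (hp : 1 ≤ p)
    (hX' : IsSmoothProjective (2 * p) X') (hX : IsSmoothProjective (2 * p) X)
    (hdeg : HasDegree μ ν (AlgPoints.mapContinuous f) ((ℓ : ℤ) ^ v * d'))
    (hf : Function.Surjective f.left.base) (hℓ : 1 ≤ ℓ) (hcop : IsCoprime (ℓ : ℤ) d') {s : ℕ}
    (hC : LevelClean ℓ s p X') : LevelClean ℓ (v + s) p X :=
  fun z hz ↦ stub_heartOfHasDegree f μ ν ℓ v d' hp hX' hX hdeg hf hℓ hcop s hC z hz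

/-- Arithmetic: a nonzero integer is `ℓ^v d'` with `gcd(ℓ, d') = 1`, for `ℓ` prime. [folklore] -/
theorem exists_eq_prime_pow_mul_coprime {ℓ : ℕ} (hℓ : ℓ.Prime) {d : ℤ} (hd : d ≠ 0) :
    ∃ (v : ℕ) (d' : ℤ), IsCoprime (ℓ : ℤ) d' ∧ d = (ℓ : ℤ) ^ v * d' := by
  have hprime : Prime (ℓ : ℤ) := Nat.prime_iff_prime_int.1 hℓ
  have hfin : FiniteMultiplicity (ℓ : ℤ) d :=
    FiniteMultiplicity.of_prime_left hprime hd
  obtain ⟨c, hc, hndvd⟩ := hfin.exists_eq_pow_mul_and_not_dvd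
  exact ⟨multiplicity (ℓ : ℤ) d, c, (Irreducible.coprime_iff_not_dvd hprime.irreducible).2 hndvd, hc⟩

/-- **The heart at a prime `ℓ` DESCENDS along every surjection carrying a nonzero degree** (any
integral orientations): for `f : X' ⟶ X` onto between smooth projective `2p`-folds with
`f(ℂ)_*[X'(ℂ)]_μ = d • [X(ℂ)]_ν`, `d ≠ 0`: `(∃ s ≥ 1, LevelClean ℓ s p X') → (∃ s ≥ 1, LevelClean ℓ s p X)`
(write `d = ℓ^v d'`, shift the level by `v`). With `stub_hasDegreeNeZeroOfSurjective` (wave 2) the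
degree datum is automatic. -/
theorem heart_of_hasDegree {p : ℕ} {X' X : SchemeOver ℂ} (f : X' ⟶ X)
    (μ : HomologicalOrientation ℤ (ComplexPoints X') (2 * (2 * p)))
    (ν : HomologicalOrientation ℤ (ComplexPoints X) (2 * (2 * p))) (hp : 1 ≤ p)
    (hX' : IsSmoothProjective (2 * p) X') (hX : IsSmoothProjective (2 * p) X) {ℓ : ℕ} (hℓ : ℓ.Prime)
    {d : ℤ} (hd : d ≠ 0) (hdeg : HasDegree μ ν (AlgPoints.mapContinuous f) d)
    (hf : Function.Surjective f.left.base) (h : ∃ s : ℕ, 1 ≤ s ∧ LevelClean ℓ s p X') :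
    ∃ s : ℕ, 1 ≤ s ∧ LevelClean ℓ s p X := by
  obtain ⟨v, d', hcop, rfl⟩ := exists_eq_prime_pow_mul_coprime hℓ hd
  obtain ⟨s, hs, hC⟩ := h
  exact ⟨v + s, by omega, levelClean_of_hasDegree_pow f μ ν hp hX' hX hdeg hf hℓ.one_lt.le hcop hC⟩

/-- **The heart at `ℓ` passes along spans `X ⟵σ X'' ⟶g Y`** with `σ` birational and `g` onto of ANY
nonzero degree (generalises lead c5's `levelClean_of_span`, which needed `ℓ ∤ deg g`): e.g. from an
abelian `2p`-fold `A` to every smooth model of `A/G` for EVERY finite group `G`, and along every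
generically finite dominant rational map. -/
theorem heart_of_span {p : ℕ} {X X'' Y : SchemeOver ℂ} (σ : X'' ⟶ X) (g : X'' ⟶ Y)
    (μ : HomologicalOrientation ℤ (ComplexPoints X'') (2 * (2 * p)))
    (ν : HomologicalOrientation ℤ (ComplexPoints Y) (2 * (2 * p))) (hp : 1 ≤ p)
    (hX : IsSmoothProjective (2 * p) X) (hX'' : IsSmoothProjective (2 * p) X'')
    (hY : IsSmoothProjective (2 * p) Y) (hσ : Literature.AlgebraicGeometry.Resolution.IsBirational σ.left)
    {d : ℤ} (hd : d ≠ 0) (hdeg : HasDegree μ ν (AlgPoints.mapContinuous g) d)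
    (hg : Function.Surjective g.left.base) {ℓ : ℕ} (hℓ : ℓ.Prime)
    (h : ∃ s : ℕ, 1 ≤ s ∧ LevelClean ℓ s p X) : ∃ s : ℕ, 1 ≤ s ∧ LevelClean ℓ s p Y :=
  heart_of_hasDegree g μ ν hp hX'' hY hℓ hd hdeg hg
    (h.imp fun s hs ↦ ⟨hs.1, (levelClean_iff_of_isBirational σ hp hX'' hX hσ ℓ s).2 hs.2⟩)

/-- An SNC witness set `⋃_{D ∈ E} supp D` is Zariski closed (finite union of supports). [folklore] -/
theorem isClosed_biUnion_support {X' : SchemeOver ℂ} (E : List X'.left.IdealSheafData) :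
    IsClosed (⋃ D ∈ E, ((D.support : Set X'.left))) :=
  Set.Finite.isClosed_biUnion (s := {D | D ∈ E}) (List.finite_toSet E) fun D _ ↦ D.support.isClosed

/-- **The SNC normal form of the heart, as an equivalence (unconditional).** Level `ℓ^s` is clean at
the smooth projective `2p`-fold `X` iff, on every smooth projective birational model `σ : X' ⟶ X` and
for every SNC boundary `E` on `X'` with `⋃ supp E ≠ X'`, the classes `z'` with `D'_{⋃ supp E}(ℓ^s, z')`
satisfy the clean-level conclusion (→: `LevelClean` is a birational invariant,
`levelClean_iff_of_isBirational`, and an SNC witness set is a closed witness set; ←: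
`stub_levelCleanOfSNCWitnessesUnconditional`). So the heart `stub_finiteLevel` is EXACTLY a statement
about complements of simple-normal-crossing divisors on smooth projective `2p`-folds. -/
theorem levelClean_iff_SNCWitnesses {p : ℕ} {X : SchemeOver ℂ} (hp : 1 ≤ p)
    (hX : IsSmoothProjective (2 * p) X) (ℓ s : ℕ) :
    LevelClean ℓ s p X ↔
      ∀ (X' : SchemeOver ℂ) (σ : X' ⟶ X) (E : List X'.left.IdealSheafData),
        IsSmoothProjective (2 * p) X' → Literature.AlgebraicGeometry.Resolution.IsBirational σ.left →
        Literature.AlgebraicGeometry.Resolution.HasSNC E →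
        (⋃ D ∈ E, ((D.support : Set X'.left))) ≠ Set.univ →
        ∀ z' : Hint X' (2 * p),
          (∃ (y : singularCohomology ℤ ℤ (complexPointsCompl X' (⋃ D ∈ E, ((D.support : Set X'.left)))) (2 * p))
              (M : ℕ), 1 ≤ M ∧ M • (res X' (⋃ D ∈ E, ((D.support : Set X'.left))) (2 * p) z' - ℓ ^ s • y) = 0) →
          ∃ w : Hint X' (2 * p), GenericallyTorsion X' (2 * p) (z' - ℓ • w) :=
  ⟨fun hC _ σ E hX' hσ _ hne z' hz' ↦
      (levelClean_iff_of_isBirational σ hp hX' hX hσ ℓ s).2 hC z' ⟨_, isClosed_biUnion_support E, hne, hz'⟩,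
    fun h z hz ↦ stub_levelCleanOfSNCWitnessesUnconditional hp hX ℓ s h z hz⟩


/-! ### Sub-goals of lead c6, wave 2 — BOTH LANDED (p172973, p173027): the degree of a surjection is a NONZERO INTEGER;
two smooth projective models of one function field have a common smooth projective birational ROOF

* `stub_hasDegreeNeZeroOfSurjective` — for `f : X' ⟶ X` a `ℂ`-morphism of smooth projective `n`-folds
  which is onto on points and ANY integral orientations `μ`, `ν` of `X'(ℂ)`, `X(ℂ)`:
  `∃ d ≠ 0, f(ℂ)_*[X'(ℂ)]_μ = d • [X(ℂ)]_ν` (Hatcher Thm. 3.26: `H_{2n}(X(ℂ);ℤ) = ℤ·[X(ℂ)]_ν` on the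
  closed connected manifold `X(ℂ)`, so `d` exists; `d ≠ 0` because `f_*` is onto on `H_{2n}(–;ℂ)` —
  Voisin I Lemma 7.28 transposed, the tree's `complexBetti_map_injective_of_surjective_of_dim_eq` +
  `surjective_homologyMap_of_injective_cohomologyMap` — and `[X'(ℂ)]_μ ⊗ 1 ≠ 0`). With
  `heart_of_hasDegree`: **the heart at `ℓ` descends along EVERY surjection of smooth projective
  `2p`-folds** (`heart_of_surjective` below).
* `stub_smoothRoofOfProjModels` — two projective models `M₁`, `M₂` of one finitely generated field
  `K/ℂ` (the tree's `Resolution.ProjModel ℂ K`) whose underlying varieties are smooth projective of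
  dimension `n` are dominated by a smooth projective `n`-fold `Y` through BIRATIONAL morphisms
  `Y ⟶ M₁.toOver`, `Y ⟶ M₂.toOver` (the join `Resolution.ProjModel.exists_join` / `join`, Zariski–Samuel
  VI §17, resolved by the tree's proved projective Hironaka `Resolution.Hironaka1964_projective_holds`;
  dimension by `height_genericPoint_eq_natCast`). With `levelClean_iff_of_isBirational`,
  `cruxAt_iff_of_isBirational`, `supportedClasses_eq_top_iff_of_isBirational`: **the heart at `(ℓ, s)`,
  C2 at `X` and the open locus 𝒮ᶜ are invariants of the FUNCTION FIELD `ℂ(X)/ℂ`** — the heart is a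
  statement about finitely generated fields of transcendence degree `2p` over `ℂ`. -/

/-- **Sub-goal `stub_hasDegreeNeZeroOfSurjective` (lead c6, wave 2), LANDED p172973
(`Theorems/…HasDegreeOfSurjective`; helpers `genericDivisibilityBounded_exists_hasDegree` — any continuous
degree exists — and `…_hasDegree_ne_zero_of_surjective`): the degree of a surjective
morphism of smooth projective `n`-folds is a nonzero integer, for any integral orientations.** -/
theorem stub_hasDegreeNeZeroOfSurjective :
    ∀ ⦃n : ℕ⦄ ⦃X' X : SchemeOver ℂ⦄ (f : X' ⟶ X)
      (μ : HomologicalOrientation ℤ (ComplexPoints X') (2 * n))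
      (ν : HomologicalOrientation ℤ (ComplexPoints X) (2 * n)),
      IsSmoothProjective n X' → IsSmoothProjective n X → Function.Surjective f.left.base →
      ∃ d : ℤ, d ≠ 0 ∧ HasDegree μ ν (AlgPoints.mapContinuous f) d :=
  Summit.HodgeConjecture.HodgeConjecture.Theorems.stub_hasDegreeNeZeroOfSurjective

/-- **Sub-goal `stub_smoothRoofOfProjModels` (lead c6, wave 2), LANDED p173027 (`Theorems/…SmoothRoof`;
helpers `height_genericPoint_eq_of_isBirational`, `ProjModel.height_genericPoint_eq_of_hom`; the `M₂`
smoothness hypothesis is idle): two smooth projective models of one function field have a common smooth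
projective birational roof.** -/
theorem stub_smoothRoofOfProjModels :
    ∀ (K : Type) [Field K] [Algebra ℂ K]
      (M₁ M₂ : Literature.AlgebraicGeometry.Resolution.ProjModel ℂ K) (n : ℕ),
      IsSmoothProjective n M₁.toOver → IsSmoothProjective n M₂.toOver →
      ∃ (Y : SchemeOver ℂ) (σ₁ : Y ⟶ M₁.toOver) (σ₂ : Y ⟶ M₂.toOver),
        IsSmoothProjective n Y ∧
        Literature.AlgebraicGeometry.Resolution.IsBirational σ₁.left ∧
        Literature.AlgebraicGeometry.Resolution.IsBirational σ₂.left :=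
  Summit.HodgeConjecture.HodgeConjecture.Theorems.stub_smoothRoofOfProjModels

/-- **The heart at `ℓ` descends along EVERY surjection of smooth projective `2p`-folds** (p172973 +
p172282; complex integral orientations on both sides; no degree hypothesis, no coprimality). -/
theorem heart_of_surjective {p : ℕ} {X' X : SchemeOver ℂ} (f : X' ⟶ X) (hp : 1 ≤ p)
    (hX' : IsSmoothProjective (2 * p) X') (hX : IsSmoothProjective (2 * p) X)
    (hf : Function.Surjective f.left.base) {ℓ : ℕ} (hℓ : ℓ.Prime)
    (h : ∃ s : ℕ, 1 ≤ s ∧ LevelClean ℓ s p X') : ∃ s : ℕ, 1 ≤ s ∧ LevelClean ℓ s p X := by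
  letI := hX'.chartedSpace
  letI := hX.chartedSpace
  haveI := ComplexPoints.t2Space_of_isSmoothProjective hX'
  haveI := ComplexPoints.t2Space_of_isSmoothProjective hX
  obtain ⟨d, hd, hdeg⟩ := stub_hasDegreeNeZeroOfSurjective f (complexOrientationInt hX')
    (complexOrientationInt hX) hX' hX hf
  exact heart_of_hasDegree f _ _ hp hX' hX hℓ hd hdeg hf h

/-- **The heart at `(ℓ, s)` is an invariant of the FUNCTION FIELD** (p173027 + `levelClean_iff_of_isBirational`) — for two projective models of one field `K/ℂ` whose varieties are smooth projective `2p`-folds,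
`LevelClean ℓ s p M₁.toOver ↔ LevelClean ℓ s p M₂.toOver`. -/
theorem levelClean_iff_of_projModels {K : Type} [Field K] [Algebra ℂ K]
    (M₁ M₂ : Literature.AlgebraicGeometry.Resolution.ProjModel ℂ K) {p : ℕ} (hp : 1 ≤ p)
    (h₁ : IsSmoothProjective (2 * p) M₁.toOver) (h₂ : IsSmoothProjective (2 * p) M₂.toOver) (ℓ s : ℕ) :
    LevelClean ℓ s p M₁.toOver ↔ LevelClean ℓ s p M₂.toOver := by
  obtain ⟨Y, σ₁, σ₂, hY, hσ₁, hσ₂⟩ := stub_smoothRoofOfProjModels K M₁ M₂ (2 * p) h₁ h₂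
  rw [← levelClean_iff_of_isBirational σ₁ hp hY h₁ hσ₁ ℓ s, levelClean_iff_of_isBirational σ₂ hp hY h₂ hσ₂ ℓ s]

/-- **The open locus of the heart is an invariant of the function field** (p173027 +
`supportedClasses_eq_top_iff_of_isBirational`) — `supportedClasses M₁.toOver (2p) 1 = ⊤ ↔ supportedClasses M₂.toOver (2p) 1 = ⊤`. -/
theorem supportedClasses_eq_top_iff_of_projModels {K : Type} [Field K] [Algebra ℂ K]
    (M₁ M₂ : Literature.AlgebraicGeometry.Resolution.ProjModel ℂ K) {p : ℕ} (hp : 1 ≤ p)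
    (h₁ : IsSmoothProjective (2 * p) M₁.toOver) (h₂ : IsSmoothProjective (2 * p) M₂.toOver) :
    supportedClasses M₁.toOver (2 * p) 1 = ⊤ ↔ supportedClasses M₂.toOver (2 * p) 1 = ⊤ := by
  obtain ⟨Y, σ₁, σ₂, hY, hσ₁, hσ₂⟩ := stub_smoothRoofOfProjModels K M₁ M₂ (2 * p) h₁ h₂
  rw [← supportedClasses_eq_top_iff_of_isBirational σ₁ hp hY h₁ hσ₁,
    supportedClasses_eq_top_iff_of_isBirational σ₂ hp hY h₂ hσ₂]

/-- **C2 at `X` is an invariant of the function field** (p173027 + `cruxAt_iff_of_isBirational`): for two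
projective models of one field `K/ℂ` whose varieties are smooth projective `2p`-folds, C2 holds at one iff
it holds at the other. -/
theorem cruxAt_iff_of_projModels {K : Type} [Field K] [Algebra ℂ K]
    (M₁ M₂ : Literature.AlgebraicGeometry.Resolution.ProjModel ℂ K) {p : ℕ} (hp : 1 ≤ p)
    (h₁ : IsSmoothProjective (2 * p) M₁.toOver) (h₂ : IsSmoothProjective (2 * p) M₂.toOver) :
    (∀ z : Hint M₁.toOver (2 * p),
      (∀ m : ℕ, 1 ≤ m → ∃ Z : Set M₁.toOver.left, IsClosed Z ∧ Z ≠ Set.univ ∧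
        ∃ y : singularCohomology ℤ ℤ (complexPointsCompl M₁.toOver Z) (2 * p),
          m • y = res M₁.toOver Z (2 * p) z) →
      singularCohomology.ringChange (Int.castRingHom ℂ) (ComplexPoints M₁.toOver) (2 * p) z ∈
        supportedClasses M₁.toOver (2 * p) 1) ↔
    (∀ z : Hint M₂.toOver (2 * p),
      (∀ m : ℕ, 1 ≤ m → ∃ Z : Set M₂.toOver.left, IsClosed Z ∧ Z ≠ Set.univ ∧
        ∃ y : singularCohomology ℤ ℤ (complexPointsCompl M₂.toOver Z) (2 * p),
          m • y = res M₂.toOver Z (2 * p) z) →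
      singularCohomology.ringChange (Int.castRingHom ℂ) (ComplexPoints M₂.toOver) (2 * p) z ∈
        supportedClasses M₂.toOver (2 * p) 1) := by
  obtain ⟨Y, σ₁, σ₂, hY, hσ₁, hσ₂⟩ := stub_smoothRoofOfProjModels K M₁ M₂ (2 * p) h₁ h₂
  exact (cruxAt_iff_of_isBirational σ₁ hp hY h₁ hσ₁).trans (cruxAt_iff_of_isBirational σ₂ hp hY h₂ hσ₂).symm

/-- **Summary of the transport calculus of the heart (leads c4–c6), `Sig` level.** The class of smooth
projective `2p`-folds at which the heart holds at the prime `ℓ` (`∃ s ≥ 1, LevelClean ℓ s p X`) is closed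
under: images of surjective morphisms (`heart_of_surjective`), birational modifications in both
directions (`levelClean_iff_of_isBirational`), change of projective model of the function field
(`levelClean_iff_of_projModels`), and spans (`heart_of_span`); and membership may be tested on SNC
witnesses only (`levelClean_iff_SNCWitnesses`). This packages the four closure properties as one
statement: the heart at `ℓ` descends along any span `X ⟵σ X'' ⟶g Y` with `σ` birational and `g` onto. -/
theorem heart_of_span' {p : ℕ} {X X'' Y : SchemeOver ℂ} (σ : X'' ⟶ X) (g : X'' ⟶ Y) (hp : 1 ≤ p)
    (hX : IsSmoothProjective (2 * p) X) (hX'' : IsSmoothProjective (2 * p) X'')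
    (hY : IsSmoothProjective (2 * p) Y) (hσ : Literature.AlgebraicGeometry.Resolution.IsBirational σ.left)
    (hg : Function.Surjective g.left.base) {ℓ : ℕ} (hℓ : ℓ.Prime)
    (h : ∃ s : ℕ, 1 ≤ s ∧ LevelClean ℓ s p X) : ∃ s : ℕ, 1 ≤ s ∧ LevelClean ℓ s p Y :=
  heart_of_surjective g hp hX'' hY hg hℓ
    (h.imp fun s hs ↦ ⟨hs.1, (levelClean_iff_of_isBirational σ hp hX'' hX hσ ℓ s).2 hs.2⟩)

/-- The crux by name, closed modulo the ONE registered stub left — the HEART `stub_finiteLevel`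
(checks that `Sig.stub_finiteLevel` is its signature verbatim); the surface case is discharged by
the landed theorems (p145990, p146835). -/
theorem genericDivisibilityBounded_of_stubs : GenericDivisibilityBounded :=
  GenericDivisibilityBounded_of stub_finiteLevel

end Summit.HodgeConjecture.HodgeConjecture.Cruxes.GenericDivisibilityBounded.FiniteLevelBootstrap

end
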